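import Mathlib.Analysis.Complex.Schwarz
import Literature.Analysis.Calculus.BCHDynkinLowOrder

/-!
# The third-order Baker–Campbell–Hausdorff expansion of a PRODUCT OF SEVERAL EXPONENTIALS, with remainder

statement-level skeleton of published theorems with citation tags; proofs where landed; nothing here is a claim about the
Yang–Mills mass gap

Continuation of `Literature.Analysis.Calculus.BCHDynkin` / `BCHDynkinLowOrder` (Dynkin's series and its cubic truncation
`bch3 X Y = X + Y + ½[X,Y] + (1/12)([X,[X,Y]] + [Y,[Y,X]])` with the fourth-order tail `≤ 1250(‖X‖+‖Y‖)⁴`,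
[Rossmann2002, §1.3 Theorem 1, Problem 2]).  This file does the MANY-FACTOR version that the lattice papers use for a
plaquette variable written as an ordered product of four bond exponentials — [Balaban1985Variational] (34) p. 283:
«`Π_{b⊂(∂p)_z} exp iηA′(b) = exp{iηΣ_b A′(b) + ½i²η²Σ_{b₁≺b₂}[A′(b₁),A′(b₂)]`
`+ (1/12)i³η³Σ_{b₁≺b₂}([A′(b₁),[A′(b₁),A′(b₂)]] + [[A′(b₁),A′(b₂)],A′(b₂)])`
`+ (1/6)i³η³Σ_{b₁≺b₂≺b₃}([A′(b₁),[A′(b₂),A′(b₃)]] + [[A′(b₁),A′(b₂)],A′(b₃)]) + …}`» — in a complex Banach algebra,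
for an ordered list `Y₁ ≺ ⋯ ≺ Yₙ` of ANY length, WITH AN EXPLICIT BOUND ON «`+ …`».

WHAT THIS FILE PROVES (`𝔸` a complete normed `ℂ`-algebra; `log` = the series `logOnePlus (· − 1)`; `[a,b] = ab − ba`):
* §0 `logOnePlus_zero`; `norm_mul_sub_one_le_of_le` (`‖xy − 1‖ ≤ e^{α+β} − 1` from `‖x − 1‖ ≤ e^α − 1`, `‖y − 1‖ ≤ e^β − 1`,
  no hypothesis on `‖1‖`; the tree's `B7Eq38Remainder.norm_exp_mul_exp_sub_one_le` is the case of two exponentials); **`logOnePlus_exp_sub_one`**: `log(e^T) = T` for `‖T‖ < log 2` (identity theorem along the complex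
  line `t ↦ tT` from the tree's local statement `ExpDifferential.eventually_logOnePlus_exp_sub_one`).
* §1 **`norm_logOnePlus_sub_bch3_le_mul`**: the two-factor tail IS LINEAR IN THE FIRST FACTOR —
  `‖log(e^X e^Y) − bch3 X Y‖ ≤ 12000·‖X‖·(‖X‖+‖Y‖)³` for `‖X‖ + ‖Y‖ ≤ 3/20` (Schwarz's lemma, Mathlib
  `Complex.dist_le_div_mul_dist_of_mapsTo_ball`, applied to `t ↦ log(e^{tX}e^Y) − bch3 (tX) Y` on the disc
  `|t|‖X‖ + ‖Y‖ < (4/3)(‖X‖+‖Y‖) ≤ 1/5`, where it is bounded by `1250σ⁴` (`BCHDynkinLowOrder`) and vanishes at `t = 0` by §0).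
* §2 the cubic BCH polynomial of an ordered list, `bch3List l = Σᵢ Yᵢ + ½ pairBr l + (1/12) pairCubic l + (1/6) tripleBr l`
  with `pairBr l = Σ_{i<j}[Yᵢ,Yⱼ]`, `pairCubic l = Σ_{i<j}([Yᵢ,[Yᵢ,Yⱼ]] + [[Yᵢ,Yⱼ],Yⱼ])`,
  `tripleBr l = Σ_{i<j<k}([Yᵢ,[Yⱼ,Yₖ]] + [[Yᵢ,Yⱼ],Yₖ])` (head recursions over any ring; closed forms `…_three/_four`,
  `bch3List_four`; `bch3List_pair : bch3List [X, Y] = bch3 X Y`), the Jacobi step `jacobi_step`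
  (`[S,[S,a]] + [a, pairBr l] = cubicAux a l + 2·tripleAux a l`), and the EXACT one-more-factor identity
  **`bch3_cons : bch3 a (bch3List l) = bch3List (a :: l) + junk a l`** (`junk` = the words of degree `≥ 4`).
* §3 sizes (`ns l = Σ‖Yᵢ‖`): `‖pairBr l‖ ≤ ns²`, `‖pairCubic l‖, ‖tripleBr l‖ ≤ (4/3)ns³`, `‖bch3List l − Σl‖ ≤ ½ns² + (1/3)ns³`,
  `‖junk a l‖ ≤ (4/3)‖a‖·(‖a‖ + ns l)³` (LINEAR in the new letter), `‖Πe^{Yᵢ} − 1‖ ≤ e^{ns} − 1`, `exp_log_prodExp`.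
* §4 `bch3_add_right_sub` / `norm_bch3_sub_bch3_le` (`‖bch3 a (B+r) − bch3 a B‖ ≤ (1 + 2‖a‖)‖r‖`), and the theorem
  **`norm_log_prodExp_sub_bch3List_le`**: for `Σ‖Yᵢ‖ ≤ 1/10`,
  `‖log(e^{Y₁}⋯e^{Yₙ}) − bch3List [Y₁,…,Yₙ]‖ ≤ 30000·(Σ‖Yᵢ‖)⁴` — constant INDEPENDENT OF `n` (induction on the list:
  §1 makes the new tail linear in the new factor, §2 is the algebra, §3 the sizes, `1 + 2‖a‖ ≤ e^{2‖a‖}` closes; sharper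
  form `norm_log_prodExp_sub_bch3List_le_exp` with `23440·e^{2Σ‖Yᵢ‖}`), `prodExp_eq_exp_bch3List_add`
  (`Πe^{Yᵢ} = exp(bch3List + R)`, `‖R‖ ≤ 30000(Σ‖Yᵢ‖)⁴`) and the four-factor case written out, `norm_log_prodExp_four_sub_le`.
* §5 (v1.1) PRINT'S REGIME `Σ‖Yᵢ‖ ≤ 1/8` ([Balaban1985Variational] (32) with «`32ε₂ ≤ 1`»: `Σ_b η|A′(b)| < 4ε₂ ≤ 1/8`):
  the Schwarz step parametric in the radius (`norm_logOnePlus_sub_bch3_le_schwarz`), the two-factor tail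
  `≤ 12960‖X‖(‖X‖+‖Y‖)³` up to `‖X‖+‖Y‖ ≤ 1/6` (`norm_logOnePlus_sub_bch3_le_mul_sixth`), and
  **`norm_log_prodExp_sub_bch3List_le_eighth`**: `‖log(e^{Y₁}⋯e^{Yₙ}) − bch3List [Y₁,…,Yₙ]‖ ≤ 40000·(Σ‖Yᵢ‖)⁴` for
  `Σ‖Yᵢ‖ ≤ 1/8` (sharper `…_le_exp_eighth` with `30722·e^{2Σ‖Yᵢ‖}`), `prodExp_eq_exp_bch3List_add_eighth`,
  `norm_log_prodExp_four_sub_le_eighth`.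
* §6 (v1.2) `norm_log_prodExp_le_eighth` (`‖log Πe^{Yᵢ}‖ ≤ (4/3)Σ‖Yᵢ‖` on `Σ‖Yᵢ‖ ≤ 1/8`) and
  `prodExp_eq_exp_bch3List_add_eighth'` (the one-exponential form WITH the size of the exponent, for the passage (34) → (36)).

HONEST SCOPE.  The constants `12000`, `23440`, `30000` (`12960`, `30722`, `40000` in §5) and the thresholds `3/20`, `1/10`
(`1/6`, `1/8` in §5) are admissible witnesses, not optimal;
nothing is claimed about the full (all-order) many-variable BCH series beyond its cubic truncation and an `O(4)` tail.  The
`n`-factor cubic polynomial is the one obtained by iterating the two-factor formula (Jacobi identity for the triple terms);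
for `n = 4` it is LETTER BY LETTER the exponent printed in [Balaban1985Variational] (34) (`bch3List_four`), for `n = 2` it
is `bch3` (`bch3List_pair`).  [Rossmann2002] prints the two-factor statement (§1.3 Theorem 1, Problem 2); the list form and the
tail constant are this file's (induction), cited to the two printed anchors.  Intended consumer:
`Literature.MathematicalPhysics.QuantumFieldTheory.Balaban1983to89.B11Eq34Analytic` ((34) with its «`+ …`» bounded).

## References
* [Rossmann2002] W. Rossmann, *Lie Groups: An Introduction Through Linear Groups*, OUP 2002, §1.3 Theorem 1 (4), Problem 2.
* [Balaban1985Variational] T. Bałaban, *The variational problem and background fields in renormalization group method for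
  lattice gauge theories*, Commun. Math. Phys. **102** (1985) 277–309, (34) p. 283.
-/

noncomputable section

open NormedSpace Filter Metric Set
open scoped Topology

namespace Literature.Analysis.Calculus.BCH

open Literature.Analysis.Calculus.ExpDifferential
open Literature.Analysis.Complex (logOnePlus logSeriesCoeff hasSum_logOnePlus norm_logOnePlus_le exp_logOnePlus_sub_one)

/-! ## §0  `log ∘ exp = id` on `‖T‖ < log 2`, and the size of a product of two exponentials -/

section LogExp

variable {𝔸 : Type*} [NormedRing 𝔸] [NormedAlgebra ℂ 𝔸] [CompleteSpace 𝔸]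

/-- `log 1 = 0` for the logarithmic series. [cite: Rossmann2002, §1.3 (before Theorem 1: the series of `log`)] -/
@[simp] theorem logOnePlus_zero : logOnePlus (0 : 𝔸) = 0 := by
  have h := hasSum_logOnePlus (x := (0 : 𝔸)) (by simp)
  have h0 : (fun n : ℕ => logSeriesCoeff n • (0 : 𝔸) ^ n) = fun _ => 0 := by
    funext n
    cases n with
    | zero => simp [logSeriesCoeff]
    | succ n => simp
  rw [h0] at h
  exact h.unique hasSum_zero

omit [NormedAlgebra ℂ 𝔸] [CompleteSpace 𝔸] in
/-- If `‖x − 1‖ ≤ e^α − 1` and `‖y − 1‖ ≤ e^β − 1` then `‖xy − 1‖ ≤ e^{α+β} − 1` (no hypothesis on `‖1‖`: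
`xy − 1 = (x−1)(y−1) + (x−1) + (y−1)`). [cite: Rossmann2002, §1.3 Theorem 1, remark after (5)] -/
theorem norm_mul_sub_one_le_of_le {x y : 𝔸} {α β : ℝ} (hx : ‖x - 1‖ ≤ Real.exp α - 1)
    (hy : ‖y - 1‖ ≤ Real.exp β - 1) : ‖x * y - 1‖ ≤ Real.exp (α + β) - 1 := by
  have hx0 : 0 ≤ Real.exp α - 1 := (norm_nonneg _).trans hx
  have h : x * y - 1 = (x - 1) * (y - 1) + (x - 1) + (y - 1) := by noncomm_ring
  rw [h, Real.exp_add]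
  calc ‖(x - 1) * (y - 1) + (x - 1) + (y - 1)‖ ≤ ‖x - 1‖ * ‖y - 1‖ + ‖x - 1‖ + ‖y - 1‖ :=
        (norm_add_le _ _).trans (add_le_add ((norm_add_le _ _).trans (add_le_add (norm_mul_le _ _) le_rfl)) le_rfl)
    _ ≤ (Real.exp α - 1) * (Real.exp β - 1) + (Real.exp α - 1) + (Real.exp β - 1) :=
        add_le_add (add_le_add (mul_le_mul hx hy (norm_nonneg _) hx0) hx) hy
    _ = Real.exp α * Real.exp β - 1 := by ring

/-- **`log(e^T) = T` for `‖T‖ < log 2`** (`log` = the series `logOnePlus (· − 1)`; the radius `log 2` makes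
`‖e^{tT} − 1‖ < 1` along the whole segment, and the identity — true near `t = 0` by the tree's
`eventually_logOnePlus_exp_sub_one` — propagates along the complex line `t ↦ tT` by the identity theorem).
[cite: Rossmann2002, §1.3 (proof of Theorem 1: «log(exp Z) = Z for Z near 0»)] -/
theorem logOnePlus_exp_sub_one {T : 𝔸} (hT : ‖T‖ < Real.log 2) : logOnePlus (exp T - 1) = T := by
  rcases eq_or_ne T 0 with rfl | hT0
  · simp
  have hTpos : 0 < ‖T‖ := norm_pos_iff.mpr hT0
  set ρ : ℝ := Real.log 2 / ‖T‖ with hρ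
  have hρ1 : 1 < ρ := by rw [hρ, lt_div_iff₀ hTpos]; linarith
  set F : ℂ → 𝔸 := fun t => logOnePlus (exp (t • T) - 1) - t • T with hF
  -- `‖e^{tT} − 1‖ < 1` on the disc `|t| < ρ`
  have hlt : ∀ t ∈ ball (0 : ℂ) ρ, ‖exp (t • T) - 1‖ < 1 := by
    intro t ht
    rw [mem_ball_zero_iff] at ht
    have h1 : ‖t • T‖ < Real.log 2 := by
      rw [norm_smul]; calc ‖t‖ * ‖T‖ < ρ * ‖T‖ := mul_lt_mul_of_pos_right ht hTpos
        _ = Real.log 2 := by rw [hρ, div_mul_cancel₀ _ hTpos.ne']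
    calc ‖exp (t • T) - 1‖ ≤ Real.exp ‖t • T‖ - 1 := norm_exp_sub_one_le_exp_norm_sub_one _
      _ < Real.exp (Real.log 2) - 1 := by gcongr
      _ = 1 := by rw [Real.exp_log two_pos]; norm_num
  have hdiff : DifferentiableOn ℂ F (ball (0 : ℂ) ρ) := by
    refine DifferentiableOn.sub ?_ (differentiable_id.smul_const T).differentiableOn
    exact Literature.Analysis.Complex.differentiableOn_logOnePlus_comp
      ((differentiable_exp_smul_const ℂ T).differentiableOn.sub_const 1) hlt
  have han : AnalyticOnNhd ℂ F (ball (0 : ℂ) ρ) := hdiff.analyticOnNhd isOpen_ball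
  -- `F = 0` near `t = 0`
  have hev : F =ᶠ[𝓝 0] 0 := by
    have hcc : Continuous fun t : ℂ => t • T := continuous_id.smul continuous_const
    have hc : Tendsto (fun t : ℂ => t • T) (𝓝 0) (𝓝 0) := by simpa using hcc.tendsto 0
    filter_upwards [hc.eventually (eventually_logOnePlus_exp_sub_one (𝔹 := 𝔸))] with t ht
    simp [hF, ht]
  have h := han.eqOn_zero_of_preconnected_of_eventuallyEq_zero (convex_ball (0 : ℂ) ρ).isPreconnected
    (mem_ball_self (by linarith)) hev (show (1 : ℂ) ∈ ball (0 : ℂ) ρ by simpa using hρ1)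
  simpa [hF, sub_eq_zero] using h

end LogExp

/-! ## §1  The two-factor tail is linear in each factor (Schwarz's lemma) -/

section Linear

variable {𝔸 : Type*} [NormedRing 𝔸] [NormedAlgebra ℂ 𝔸]

/-- `bch3 0 Y = Y`. [cite: Rossmann2002, §1.3 Problem 2] -/
@[simp] theorem bch3_zero_left (Y : 𝔸) : bch3 0 Y = Y := by simp [bch3]

/-- `bch3 X 0 = X`. [cite: Rossmann2002, §1.3 Problem 2] -/
@[simp] theorem bch3_zero_right (X : 𝔸) : bch3 X 0 = X := by simp [bch3]

/-- `t ↦ bch3 (tX) Y` is differentiable (a polynomial in `t`). [cite: Rossmann2002, §1.3 Problem 2] -/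
theorem differentiable_bch3_smul_left (X Y : 𝔸) : Differentiable ℂ fun t : ℂ => bch3 (t • X) Y := by
  unfold bch3; fun_prop

variable [CompleteSpace 𝔸]

/-- `1/5 < log 2` (numerics). [cite: Rossmann2002, §1.3 Theorem 1 (radius of convergence)] -/
theorem one_fifth_lt_log_two : (1 : ℝ) / 5 < Real.log 2 := by
  have := Real.log_two_gt_d9; linarith

/-- **THE TWO-FACTOR TAIL IS LINEAR IN THE FIRST FACTOR**: for `‖X‖ + ‖Y‖ ≤ 3/20`,
`‖log(e^X e^Y) − bch3 X Y‖ ≤ 12000·‖X‖·(‖X‖ + ‖Y‖)³`.  Proof: `f(t) = log(e^{tX}e^Y) − bch3 (tX) Y` is holomorphic on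
`|t| < R₁ := ((4/3)(a+b) − b)/a` (`a = ‖X‖`, `b = ‖Y‖`), vanishes at `0` (§0) and is bounded there by `1250σ⁴`,
`σ = (4/3)(a+b) ≤ 1/5` (`norm_logOnePlus_sub_bch3_le`); Schwarz's lemma gives `‖f(1)‖ ≤ 1250σ⁴/R₁ ≤ 12000·a(a+b)³`.
[cite: Rossmann2002, §1.3 Theorem 1 (4), remark after (5), Problem 2] -/
theorem norm_logOnePlus_sub_bch3_le_mul (X Y : 𝔸) (h : ‖X‖ + ‖Y‖ ≤ 3 / 20) :
    ‖logOnePlus (exp X * exp Y - 1) - bch3 X Y‖ ≤ 12000 * ‖X‖ * (‖X‖ + ‖Y‖) ^ 3 := by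
  have hlog2 := one_fifth_lt_log_two
  rcases eq_or_ne X 0 with rfl | hX0
  · have hY : ‖Y‖ < Real.log 2 := by rw [norm_zero, zero_add] at h; linarith
    simp [logOnePlus_exp_sub_one hY]
  set a : ℝ := ‖X‖ with ha
  set b : ℝ := ‖Y‖ with hb
  have ha0 : 0 < a := norm_pos_iff.mpr hX0
  have hb0 : 0 ≤ b := norm_nonneg Y
  set σ : ℝ := 4 / 3 * (a + b) with hσ
  have hσ5 : σ ≤ 1 / 5 := by rw [hσ]; linarith
  set R₁ : ℝ := (σ - b) / a with hR₁
  have hR₁a : R₁ * a = σ - b := by rw [hR₁, div_mul_cancel₀ _ ha0.ne']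
  have hR₁1 : 1 < R₁ := by rw [hR₁, lt_div_iff₀ ha0]; rw [hσ]; linarith
  have hR₁0 : 0 < R₁ := by linarith
  set f : ℂ → 𝔸 := fun t => logOnePlus (exp (t • X) * exp Y - 1) - bch3 (t • X) Y with hf
  have hY2 : ‖Y‖ < Real.log 2 := by linarith [ha0.le, norm_nonneg X]
  have hf0 : f 0 = 0 := by simp [hf, logOnePlus_exp_sub_one hY2]
  -- sizes on the disc
  have hsum : ∀ t ∈ ball (0 : ℂ) R₁, ‖t • X‖ + ‖Y‖ < σ := by
    intro t ht
    rw [mem_ball_zero_iff] at ht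
    rw [norm_smul]
    calc ‖t‖ * ‖X‖ + ‖Y‖ < R₁ * a + b := by rw [← ha, ← hb]; gcongr
      _ = σ := by rw [hR₁a]; ring
  have hlt : ∀ t ∈ ball (0 : ℂ) R₁, ‖exp (t • X) * exp Y - 1‖ < 1 := by
    intro t ht
    calc ‖exp (t • X) * exp Y - 1‖ ≤ Real.exp (‖t • X‖ + ‖Y‖) - 1 :=
          norm_mul_sub_one_le_of_le (norm_exp_sub_one_le_exp_norm_sub_one _)
            (norm_exp_sub_one_le_exp_norm_sub_one _)
      _ < Real.exp (Real.log 2) - 1 := by gcongr; linarith [hsum t ht, hσ5, hlog2]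
      _ = 1 := by rw [Real.exp_log two_pos]; norm_num
  have hdiff : DifferentiableOn ℂ f (ball (0 : ℂ) R₁) := by
    refine DifferentiableOn.sub ?_ (differentiable_bch3_smul_left X Y).differentiableOn
    exact Literature.Analysis.Complex.differentiableOn_logOnePlus_comp
      (((differentiable_exp_smul_const ℂ X).mul_const (exp Y)).sub_const 1).differentiableOn hlt
  have hmaps : MapsTo f (ball (0 : ℂ) R₁) (closedBall (f 0) (1250 * σ ^ 4)) := by
    intro t ht
    rw [hf0, mem_closedBall_zero_iff]
    have hs := hsum t ht
    calc ‖f t‖ ≤ 1250 * (‖t • X‖ + ‖Y‖) ^ 4 := norm_logOnePlus_sub_bch3_le _ _ (by linarith)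
      _ ≤ 1250 * σ ^ 4 := by gcongr
  have h1 : (1 : ℂ) ∈ ball (0 : ℂ) R₁ := by simpa using hR₁1
  have hS := Complex.dist_le_div_mul_dist_of_mapsTo_ball hdiff hmaps h1
  rw [hf0, dist_zero_right, dist_zero_right, norm_one, mul_one] at hS
  have hf1 : f 1 = logOnePlus (exp X * exp Y - 1) - bch3 X Y := by simp [hf]
  rw [hf1] at hS
  refine hS.trans ?_
  -- `1250σ⁴/R₁ ≤ 12000·a(a+b)³`
  rw [div_le_iff₀ hR₁0]
  have hab : 0 < a + b := by linarith
  have key : 1250 * σ ^ 4 ≤ 12000 * a * (a + b) ^ 3 * R₁ := by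
    have e1 : 12000 * a * (a + b) ^ 3 * R₁ = 4000 * (a + b) ^ 3 * (4 * a + b) := by
      have : 12000 * a * (a + b) ^ 3 * R₁ = 12000 * (a + b) ^ 3 * (R₁ * a) := by ring
      rw [this, hR₁a, hσ]; ring
    rw [e1, hσ]
    have h3 : 0 ≤ (a + b) ^ 3 := by positivity
    nlinarith [h3, ha0.le, hb0]
  simpa [ha, hb] using key

end Linear

/-! ## §2  The cubic BCH polynomial of an ordered list and the exact one-more-factor identity -/

section RingPolys

variable {𝔸 : Type*} [Ring 𝔸]

/-- `pairBr [Y₁,…,Yₙ] = Σ_{i<j} [Yᵢ, Yⱼ]` (head recursion: `pairBr (a :: l) = [a, Σl] + pairBr l`) — twice the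
second-order exponent `½Σ_{b₁≺b₂}[A′(b₁),A′(b₂)]` of (34). [cite: Balaban1985Variational, (34) p.283] -/
def pairBr : List 𝔸 → 𝔸
  | [] => 0
  | a :: l => ⁅a, l.sum⁆ + pairBr l

/-- `cubicAux a [Y₁,…,Yₙ] = Σⱼ [[a, Yⱼ], Yⱼ]` (the part of `pairCubic (a :: l)` quadratic in the tail letters).
[cite: Balaban1985Variational, (34) p.283] -/
def cubicAux (a : 𝔸) : List 𝔸 → 𝔸
  | [] => 0
  | b :: l => ⁅⁅a, b⁆, b⁆ + cubicAux a l

/-- `pairCubic [Y₁,…,Yₙ] = Σ_{i<j} ([Yᵢ,[Yᵢ,Yⱼ]] + [[Yᵢ,Yⱼ],Yⱼ])` (head recursion) — `12×` the pair part of the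
third-order exponent of (34). [cite: Balaban1985Variational, (34) p.283] -/
def pairCubic : List 𝔸 → 𝔸
  | [] => 0
  | a :: l => (⁅a, ⁅a, l.sum⁆⁆ + cubicAux a l) + pairCubic l

/-- `tripleAux a [Y₁,…,Yₙ] = Σ_{j<k} [[a, Yⱼ], Yₖ]` (the part of `tripleBr (a :: l)` of the shape `[[a,·],·]`).
[cite: Balaban1985Variational, (34) p.283] -/
def tripleAux (a : 𝔸) : List 𝔸 → 𝔸
  | [] => 0
  | b :: l => ⁅⁅a, b⁆, l.sum⁆ + tripleAux a l

/-- `tripleBr [Y₁,…,Yₙ] = Σ_{i<j<k} ([Yᵢ,[Yⱼ,Yₖ]] + [[Yᵢ,Yⱼ],Yₖ])` (head recursion) — `6×` the triple part of the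
third-order exponent of (34). [cite: Balaban1985Variational, (34) p.283] -/
def tripleBr : List 𝔸 → 𝔸
  | [] => 0
  | a :: l => (⁅a, pairBr l⁆ + tripleAux a l) + tripleBr l

/-- Unfolding. [cite: Balaban1985Variational, (34) p.283] -/
@[simp] theorem pairBr_nil : pairBr ([] : List 𝔸) = 0 := rfl
/-- Unfolding. [cite: Balaban1985Variational, (34) p.283] -/
@[simp] theorem pairBr_cons (a : 𝔸) (l : List 𝔸) : pairBr (a :: l) = ⁅a, l.sum⁆ + pairBr l := rfl
/-- Unfolding. [cite: Balaban1985Variational, (34) p.283] -/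
@[simp] theorem cubicAux_nil (a : 𝔸) : cubicAux a [] = 0 := rfl
/-- Unfolding. [cite: Balaban1985Variational, (34) p.283] -/
@[simp] theorem cubicAux_cons (a b : 𝔸) (l : List 𝔸) : cubicAux a (b :: l) = ⁅⁅a, b⁆, b⁆ + cubicAux a l := rfl
/-- Unfolding. [cite: Balaban1985Variational, (34) p.283] -/
@[simp] theorem pairCubic_nil : pairCubic ([] : List 𝔸) = 0 := rfl
/-- Unfolding. [cite: Balaban1985Variational, (34) p.283] -/
@[simp] theorem pairCubic_cons (a : 𝔸) (l : List 𝔸) :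
    pairCubic (a :: l) = (⁅a, ⁅a, l.sum⁆⁆ + cubicAux a l) + pairCubic l := rfl
/-- Unfolding. [cite: Balaban1985Variational, (34) p.283] -/
@[simp] theorem tripleAux_nil (a : 𝔸) : tripleAux a [] = 0 := rfl
/-- Unfolding. [cite: Balaban1985Variational, (34) p.283] -/
@[simp] theorem tripleAux_cons (a b : 𝔸) (l : List 𝔸) :
    tripleAux a (b :: l) = ⁅⁅a, b⁆, l.sum⁆ + tripleAux a l := rfl
/-- Unfolding. [cite: Balaban1985Variational, (34) p.283] -/
@[simp] theorem tripleBr_nil : tripleBr ([] : List 𝔸) = 0 := rfl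
/-- Unfolding. [cite: Balaban1985Variational, (34) p.283] -/
@[simp] theorem tripleBr_cons (a : 𝔸) (l : List 𝔸) :
    tripleBr (a :: l) = (⁅a, pairBr l⁆ + tripleAux a l) + tripleBr l := rfl

/-- Closed form, three factors: `pairBr [a,b,c] = [a,b] + [a,c] + [b,c]`. [cite: Balaban1985Variational, (34) p.283] -/
theorem pairBr_three (a b c : 𝔸) : pairBr [a, b, c] = ⁅a, b⁆ + ⁅a, c⁆ + ⁅b, c⁆ := by
  simp only [pairBr_cons, pairBr_nil, List.sum_cons, List.sum_nil, add_zero, Ring.lie_def]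
  noncomm_ring

/-- Closed form, four factors: `pairBr [a,b,c,d] = Σ_{i<j}[Yᵢ,Yⱼ]` written out — print's `Σ_{b₁≺b₂}[A′(b₁),A′(b₂)]`.
[cite: Balaban1985Variational, (34) p.283] -/
theorem pairBr_four (a b c d : 𝔸) :
    pairBr [a, b, c, d] = ⁅a, b⁆ + ⁅a, c⁆ + ⁅a, d⁆ + ⁅b, c⁆ + ⁅b, d⁆ + ⁅c, d⁆ := by
  simp only [pairBr_cons, pairBr_nil, List.sum_cons, List.sum_nil, add_zero, Ring.lie_def]
  noncomm_ring

/-- Closed form, three factors. [cite: Balaban1985Variational, (34) p.283] -/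
theorem pairCubic_three (a b c : 𝔸) : pairCubic [a, b, c] =
    (⁅a, ⁅a, b⁆⁆ + ⁅⁅a, b⁆, b⁆) + (⁅a, ⁅a, c⁆⁆ + ⁅⁅a, c⁆, c⁆) + (⁅b, ⁅b, c⁆⁆ + ⁅⁅b, c⁆, c⁆) := by
  simp only [pairCubic_cons, pairCubic_nil, cubicAux_cons, cubicAux_nil, List.sum_cons, List.sum_nil, add_zero,
    Ring.lie_def]
  noncomm_ring

/-- Closed form, four factors — print's `Σ_{b₁≺b₂}([A′(b₁),[A′(b₁),A′(b₂)]] + [[A′(b₁),A′(b₂)],A′(b₂)])` written out.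
[cite: Balaban1985Variational, (34) p.283] -/
theorem pairCubic_four (a b c d : 𝔸) : pairCubic [a, b, c, d] =
    (⁅a, ⁅a, b⁆⁆ + ⁅⁅a, b⁆, b⁆) + (⁅a, ⁅a, c⁆⁆ + ⁅⁅a, c⁆, c⁆) + (⁅a, ⁅a, d⁆⁆ + ⁅⁅a, d⁆, d⁆)
      + (⁅b, ⁅b, c⁆⁆ + ⁅⁅b, c⁆, c⁆) + (⁅b, ⁅b, d⁆⁆ + ⁅⁅b, d⁆, d⁆) + (⁅c, ⁅c, d⁆⁆ + ⁅⁅c, d⁆, d⁆) := by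
  simp only [pairCubic_cons, pairCubic_nil, cubicAux_cons, cubicAux_nil, List.sum_cons, List.sum_nil, add_zero,
    Ring.lie_def]
  noncomm_ring

/-- Closed form, three factors: `tripleBr [a,b,c] = [a,[b,c]] + [[a,b],c]`. [cite: Balaban1985Variational, (34) p.283] -/
theorem tripleBr_three (a b c : 𝔸) : tripleBr [a, b, c] = ⁅a, ⁅b, c⁆⁆ + ⁅⁅a, b⁆, c⁆ := by
  simp only [tripleBr_cons, tripleBr_nil, tripleAux_cons, tripleAux_nil, pairBr_cons, pairBr_nil, List.sum_cons,
    List.sum_nil, add_zero, Ring.lie_def]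
  noncomm_ring

/-- Closed form, four factors — print's `Σ_{b₁≺b₂≺b₃}([A′(b₁),[A′(b₂),A′(b₃)]] + [[A′(b₁),A′(b₂)],A′(b₃)])`
written out. [cite: Balaban1985Variational, (34) p.283] -/
theorem tripleBr_four (a b c d : 𝔸) : tripleBr [a, b, c, d] =
    (⁅a, ⁅b, c⁆⁆ + ⁅⁅a, b⁆, c⁆) + (⁅a, ⁅b, d⁆⁆ + ⁅⁅a, b⁆, d⁆) + (⁅a, ⁅c, d⁆⁆ + ⁅⁅a, c⁆, d⁆)
      + (⁅b, ⁅c, d⁆⁆ + ⁅⁅b, c⁆, d⁆) := by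
  simp only [tripleBr_cons, tripleBr_nil, tripleAux_cons, tripleAux_nil, pairBr_cons, pairBr_nil, List.sum_cons,
    List.sum_nil, add_zero, Ring.lie_def]
  noncomm_ring

/-- **JACOBI STEP** (the identity that reconciles the iterated two-factor cubic term with the printed triple term):
`[S,[S,a]] + [a, pairBr l] = cubicAux a l + 2·tripleAux a l`, `S = Σl` — letter by letter,
`[Yⱼ,[Yₖ,a]] + [Yₖ,[Yⱼ,a]] + [a,[Yⱼ,Yₖ]] = 2[[a,Yⱼ],Yₖ]` (Jacobi). [cite: Rossmann2002, §1.3 Problem 2] -/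
theorem jacobi_step (a : 𝔸) (l : List 𝔸) :
    ⁅l.sum, ⁅l.sum, a⁆⁆ + ⁅a, pairBr l⁆ = cubicAux a l + 2 • tripleAux a l := by
  induction l with
  | nil => simp [Ring.lie_def]
  | cons b l ih =>
    simp only [List.sum_cons, pairBr_cons, cubicAux_cons, tripleAux_cons, smul_add]
    rw [← sub_eq_zero]
    have key : ⁅b + l.sum, ⁅b + l.sum, a⁆⁆ + ⁅a, ⁅b, l.sum⁆ + pairBr l⁆ -
        (⁅⁅a, b⁆, b⁆ + cubicAux a l + (2 • ⁅⁅a, b⁆, l.sum⁆ + 2 • tripleAux a l)) =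
        ⁅l.sum, ⁅l.sum, a⁆⁆ + ⁅a, pairBr l⁆ - (cubicAux a l + 2 • tripleAux a l) := by
      simp only [Ring.lie_def, two_smul]
      noncomm_ring
    rw [key, sub_eq_zero, ih]

end RingPolys

section Polys

variable {𝔸 : Type*} [NormedRing 𝔸] [NormedAlgebra ℂ 𝔸]

/-- **The cubic Baker–Campbell–Hausdorff polynomial of an ordered product** `e^{Y₁}⋯e^{Yₙ}`:
`Σᵢ Yᵢ + ½Σ_{i<j}[Yᵢ,Yⱼ] + (1/12)Σ_{i<j}([Yᵢ,[Yᵢ,Yⱼ]] + [[Yᵢ,Yⱼ],Yⱼ]) + (1/6)Σ_{i<j<k}([Yᵢ,[Yⱼ,Yₖ]] + [[Yᵢ,Yⱼ],Yₖ])`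
— the displayed exponent of (34). [cite: Balaban1985Variational, (34) p.283] -/
def bch3List (l : List 𝔸) : 𝔸 :=
  l.sum + (2 : ℂ)⁻¹ • pairBr l + (12 : ℂ)⁻¹ • pairCubic l + (6 : ℂ)⁻¹ • tripleBr l

/-- `bch3List [] = 0`. [cite: Balaban1985Variational, (34) p.283] -/
@[simp] theorem bch3List_nil : bch3List ([] : List 𝔸) = 0 := by simp [bch3List]

/-- One factor: `bch3List [X] = X`. [cite: Balaban1985Variational, (34) p.283] -/
@[simp] theorem bch3List_singleton (X : 𝔸) : bch3List [X] = X := by simp [bch3List, Ring.lie_def]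

/-- Two factors: the list polynomial IS the cubic BCH polynomial `bch3` of `BCHDynkinLowOrder`
(`[[X,Y],Y] = [Y,[Y,X]]`). [cite: Rossmann2002, §1.3 Problem 2] -/
theorem bch3List_pair (X Y : 𝔸) : bch3List [X, Y] = bch3 X Y := by
  simp only [bch3List, bch3, List.sum_cons, List.sum_nil, add_zero, pairBr_cons, pairBr_nil, pairCubic_cons,
    pairCubic_nil, cubicAux_cons, cubicAux_nil, tripleBr_cons, tripleBr_nil, tripleAux_cons, tripleAux_nil,
    Ring.lie_def, mul_zero, zero_mul, sub_self, smul_zero]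
  simp only [mul_sub, sub_mul, mul_assoc, smul_sub, smul_add]
  module

/-- `bch3List [a,b,c,d]` written out: the exponent of (34) for four ordered letters (with `Yᵢ = iηA′(bᵢ)` the scalars
`i^kη^k` are absorbed in the letters). [cite: Balaban1985Variational, (34) p.283] -/
theorem bch3List_four (a b c d : 𝔸) : bch3List [a, b, c, d] =
    (a + b + c + d) + (2 : ℂ)⁻¹ • (⁅a, b⁆ + ⁅a, c⁆ + ⁅a, d⁆ + ⁅b, c⁆ + ⁅b, d⁆ + ⁅c, d⁆)
      + (12 : ℂ)⁻¹ • ((⁅a, ⁅a, b⁆⁆ + ⁅⁅a, b⁆, b⁆) + (⁅a, ⁅a, c⁆⁆ + ⁅⁅a, c⁆, c⁆) + (⁅a, ⁅a, d⁆⁆ + ⁅⁅a, d⁆, d⁆)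
          + (⁅b, ⁅b, c⁆⁆ + ⁅⁅b, c⁆, c⁆) + (⁅b, ⁅b, d⁆⁆ + ⁅⁅b, d⁆, d⁆) + (⁅c, ⁅c, d⁆⁆ + ⁅⁅c, d⁆, d⁆))
      + (6 : ℂ)⁻¹ • ((⁅a, ⁅b, c⁆⁆ + ⁅⁅a, b⁆, c⁆) + (⁅a, ⁅b, d⁆⁆ + ⁅⁅a, b⁆, d⁆) + (⁅a, ⁅c, d⁆⁆ + ⁅⁅a, c⁆, d⁆)
          + (⁅b, ⁅c, d⁆⁆ + ⁅⁅b, c⁆, d⁆)) := by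
  rw [bch3List, pairBr_four, pairCubic_four, tripleBr_four]
  simp [add_assoc]

/-- The words of degree `≥ 4` created by one more factor: with `S = Σl`, `B = bch3List l`, `E = B − S`,
`E₃ = E − ½ pairBr l`: `junk a l = ½[a,E₃] + (1/12)([a,[a,E]] + [S,[E,a]] + [E,[B,a]])`.
[cite: Rossmann2002, §1.3 Problem 2] -/
def junk (a : 𝔸) (l : List 𝔸) : 𝔸 :=
  (2 : ℂ)⁻¹ • ⁅a, bch3List l - l.sum - (2 : ℂ)⁻¹ • pairBr l⁆ +
    (12 : ℂ)⁻¹ • (⁅a, ⁅a, bch3List l - l.sum⁆⁆ + ⁅l.sum, ⁅bch3List l - l.sum, a⁆⁆ +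
      ⁅bch3List l - l.sum, ⁅bch3List l, a⁆⁆)

/-- **THE EXACT ONE-MORE-FACTOR IDENTITY**: `bch3 a (bch3List l) = bch3List (a :: l) + junk a l` — the cubic
two-factor polynomial of `a` and the cubic polynomial of the tail equals the cubic polynomial of the longer list up to
words of degree `≥ 4` (uses `jacobi_step` for the triple terms). [cite: Rossmann2002, §1.3 Problem 2] -/
theorem bch3_cons (a : 𝔸) (l : List 𝔸) : bch3 a (bch3List l) = bch3List (a :: l) + junk a l := by
  have hJ := jacobi_step a l
  -- eliminate `cubicAux` by the Jacobi step
  have hM : cubicAux a l = ⁅l.sum, ⁅l.sum, a⁆⁆ + ⁅a, pairBr l⁆ - 2 • tripleAux a l := by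
    rw [hJ]; abel
  simp only [bch3, bch3List, junk, List.sum_cons, pairBr_cons, pairCubic_cons, tripleBr_cons, hM, Ring.lie_def,
    two_smul]
  simp only [mul_sub, sub_mul, mul_add, add_mul, mul_assoc, smul_sub, smul_add, mul_smul_comm, smul_mul_assoc,
    smul_smul]
  module

end Polys

/-! ## §3  Sizes: the norm sum of a list and the norms of the polynomials -/

section Norms

variable {𝔸 : Type*} [NormedRing 𝔸] [NormedAlgebra ℂ 𝔸]

omit [NormedAlgebra ℂ 𝔸] in
/-- `‖[a,b]‖ ≤ 2‖a‖‖b‖` (file-local copy of the tree's `B11Eq37NormBound.norm_lie_le`, which lives downstream of this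
generic file and cannot be imported here). [cite: Rossmann2002, §1.3 Theorem 1, remark after (5)] -/
private theorem norm_br_le (a b : 𝔸) : ‖⁅a, b⁆‖ ≤ 2 * ‖a‖ * ‖b‖ := by
  rw [Ring.lie_def]
  calc ‖a * b - b * a‖ ≤ ‖a * b‖ + ‖b * a‖ := norm_sub_le _ _
    _ ≤ ‖a‖ * ‖b‖ + ‖b‖ * ‖a‖ := add_le_add (norm_mul_le _ _) (norm_mul_le _ _)
    _ = 2 * ‖a‖ * ‖b‖ := by ring

/-- `ns [Y₁,…,Yₙ] = Σᵢ ‖Yᵢ‖`, the size of an ordered list (head recursion). [cite: Rossmann2002, §1.3 Theorem 1, remark after (5)] -/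
def ns : List 𝔸 → ℝ
  | [] => 0
  | a :: l => ‖a‖ + ns l

omit [NormedAlgebra ℂ 𝔸] in
/-- Unfolding. [cite: Rossmann2002, §1.3 Theorem 1, remark after (5)] -/
@[simp] theorem ns_nil : ns ([] : List 𝔸) = 0 := rfl

omit [NormedAlgebra ℂ 𝔸] in
/-- Unfolding. [cite: Rossmann2002, §1.3 Theorem 1, remark after (5)] -/
@[simp] theorem ns_cons (a : 𝔸) (l : List 𝔸) : ns (a :: l) = ‖a‖ + ns l := rfl

omit [NormedAlgebra ℂ 𝔸] in
/-- `0 ≤ ns l`. [cite: Rossmann2002, §1.3 Theorem 1, remark after (5)] -/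
theorem ns_nonneg (l : List 𝔸) : 0 ≤ ns l := by
  induction l with
  | nil => simp
  | cons a l ih => rw [ns_cons]; positivity

omit [NormedAlgebra ℂ 𝔸] in
/-- `‖Σl‖ ≤ ns l`. [cite: Rossmann2002, §1.3 Theorem 1, remark after (5)] -/
theorem norm_sum_le_ns (l : List 𝔸) : ‖l.sum‖ ≤ ns l := by
  induction l with
  | nil => simp
  | cons a l ih => rw [List.sum_cons, ns_cons]; exact (norm_add_le _ _).trans (by linarith)

omit [NormedAlgebra ℂ 𝔸] in
/-- `‖pairBr l‖ ≤ (ns l)²`. [cite: Rossmann2002, §1.3 Theorem 1, remark after (5)] -/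
theorem norm_pairBr_le (l : List 𝔸) : ‖pairBr l‖ ≤ ns l ^ 2 := by
  induction l with
  | nil => simp
  | cons a l ih =>
    rw [pairBr_cons, ns_cons]
    have h1 : ‖⁅a, l.sum⁆‖ ≤ 2 * ‖a‖ * ns l :=
      (norm_br_le _ _).trans (by gcongr; exact norm_sum_le_ns l)
    have ha := norm_nonneg a
    calc ‖⁅a, l.sum⁆ + pairBr l‖ ≤ 2 * ‖a‖ * ns l + ns l ^ 2 := (norm_add_le _ _).trans (add_le_add h1 ih)
      _ ≤ (‖a‖ + ns l) ^ 2 := by nlinarith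

omit [NormedAlgebra ℂ 𝔸] in
/-- `‖cubicAux a l‖ ≤ 4‖a‖(ns l)²`. [cite: Rossmann2002, §1.3 Theorem 1, remark after (5)] -/
theorem norm_cubicAux_le (a : 𝔸) (l : List 𝔸) : ‖cubicAux a l‖ ≤ 4 * ‖a‖ * ns l ^ 2 := by
  induction l with
  | nil => simp
  | cons b l ih =>
    rw [cubicAux_cons, ns_cons]
    have h1 : ‖⁅⁅a, b⁆, b⁆‖ ≤ 4 * ‖a‖ * ‖b‖ ^ 2 := by
      calc ‖⁅⁅a, b⁆, b⁆‖ ≤ 2 * ‖⁅a, b⁆‖ * ‖b‖ := norm_br_le _ _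
        _ ≤ 2 * (2 * ‖a‖ * ‖b‖) * ‖b‖ := by gcongr; exact norm_br_le _ _
        _ = 4 * ‖a‖ * ‖b‖ ^ 2 := by ring
    have ha := norm_nonneg a
    have hb := norm_nonneg b
    have hl := ns_nonneg l
    calc ‖⁅⁅a, b⁆, b⁆ + cubicAux a l‖ ≤ 4 * ‖a‖ * ‖b‖ ^ 2 + 4 * ‖a‖ * ns l ^ 2 :=
        (norm_add_le _ _).trans (add_le_add h1 ih)
      _ ≤ 4 * ‖a‖ * (‖b‖ + ns l) ^ 2 := by nlinarith [mul_nonneg ha (mul_nonneg hb hl)]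

omit [NormedAlgebra ℂ 𝔸] in
/-- `‖pairCubic l‖ ≤ (4/3)(ns l)³`. [cite: Rossmann2002, §1.3 Theorem 1, remark after (5)] -/
theorem norm_pairCubic_le (l : List 𝔸) : ‖pairCubic l‖ ≤ 4 / 3 * ns l ^ 3 := by
  induction l with
  | nil => simp
  | cons a l ih =>
    rw [pairCubic_cons, ns_cons]
    have h1 : ‖⁅a, ⁅a, l.sum⁆⁆‖ ≤ 4 * ‖a‖ ^ 2 * ns l := by
      calc ‖⁅a, ⁅a, l.sum⁆⁆‖ ≤ 2 * ‖a‖ * ‖⁅a, l.sum⁆‖ := norm_br_le _ _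
        _ ≤ 2 * ‖a‖ * (2 * ‖a‖ * ns l) := by
          gcongr; exact (norm_br_le _ _).trans (by gcongr; exact norm_sum_le_ns l)
        _ = 4 * ‖a‖ ^ 2 * ns l := by ring
    have h2 := norm_cubicAux_le a l
    have ha := norm_nonneg a
    have hl := ns_nonneg l
    calc ‖⁅a, ⁅a, l.sum⁆⁆ + cubicAux a l + pairCubic l‖
        ≤ 4 * ‖a‖ ^ 2 * ns l + 4 * ‖a‖ * ns l ^ 2 + 4 / 3 * ns l ^ 3 :=
          (norm_add_le _ _).trans (add_le_add ((norm_add_le _ _).trans (add_le_add h1 h2)) ih)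
      _ ≤ 4 / 3 * (‖a‖ + ns l) ^ 3 := by nlinarith [pow_nonneg ha 3]

omit [NormedAlgebra ℂ 𝔸] in
/-- `‖tripleAux a l‖ ≤ 2‖a‖(ns l)²`. [cite: Rossmann2002, §1.3 Theorem 1, remark after (5)] -/
theorem norm_tripleAux_le (a : 𝔸) (l : List 𝔸) : ‖tripleAux a l‖ ≤ 2 * ‖a‖ * ns l ^ 2 := by
  induction l with
  | nil => simp
  | cons b l ih =>
    rw [tripleAux_cons, ns_cons]
    have h1 : ‖⁅⁅a, b⁆, l.sum⁆‖ ≤ 4 * ‖a‖ * ‖b‖ * ns l := by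
      calc ‖⁅⁅a, b⁆, l.sum⁆‖ ≤ 2 * ‖⁅a, b⁆‖ * ‖l.sum‖ := norm_br_le _ _
        _ ≤ 2 * (2 * ‖a‖ * ‖b‖) * ns l := by
          gcongr
          · exact norm_br_le _ _
          · exact norm_sum_le_ns l
        _ = 4 * ‖a‖ * ‖b‖ * ns l := by ring
    have ha := norm_nonneg a
    have hb := norm_nonneg b
    have hl := ns_nonneg l
    calc ‖⁅⁅a, b⁆, l.sum⁆ + tripleAux a l‖ ≤ 4 * ‖a‖ * ‖b‖ * ns l + 2 * ‖a‖ * ns l ^ 2 :=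
        (norm_add_le _ _).trans (add_le_add h1 ih)
      _ ≤ 2 * ‖a‖ * (‖b‖ + ns l) ^ 2 := by nlinarith [mul_nonneg ha (mul_nonneg hb hb)]

omit [NormedAlgebra ℂ 𝔸] in
/-- `‖tripleBr l‖ ≤ (4/3)(ns l)³`. [cite: Rossmann2002, §1.3 Theorem 1, remark after (5)] -/
theorem norm_tripleBr_le (l : List 𝔸) : ‖tripleBr l‖ ≤ 4 / 3 * ns l ^ 3 := by
  induction l with
  | nil => simp
  | cons a l ih =>
    rw [tripleBr_cons, ns_cons]
    have h1 : ‖⁅a, pairBr l⁆‖ ≤ 2 * ‖a‖ * ns l ^ 2 :=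
      (norm_br_le _ _).trans (by gcongr; exact norm_pairBr_le l)
    have h2 := norm_tripleAux_le a l
    have ha := norm_nonneg a
    have hl := ns_nonneg l
    calc ‖⁅a, pairBr l⁆ + tripleAux a l + tripleBr l‖
        ≤ 2 * ‖a‖ * ns l ^ 2 + 2 * ‖a‖ * ns l ^ 2 + 4 / 3 * ns l ^ 3 :=
          (norm_add_le _ _).trans (add_le_add ((norm_add_le _ _).trans (add_le_add h1 h2)) ih)
      _ ≤ 4 / 3 * (‖a‖ + ns l) ^ 3 := by nlinarith [pow_nonneg ha 3, mul_nonneg (mul_nonneg ha ha) hl]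

/-- `‖(1/n)x‖ = (1/n)‖x‖` for the complex scalars `½`, `1/12`, `1/6`. [cite: Rossmann2002, §1.3 Problem 2] -/
theorem norm_inv_smul (n : ℕ) [n.AtLeastTwo] (x : 𝔸) :
    ‖((OfNat.ofNat n : ℂ))⁻¹ • x‖ = ((OfNat.ofNat n : ℝ))⁻¹ * ‖x‖ := by
  rw [norm_smul, norm_inv, Complex.norm_ofNat]

/-- The part of `bch3List l` of degree `≥ 2`: `‖bch3List l − Σl‖ ≤ ½ns² + (1/3)ns³`.
[cite: Rossmann2002, §1.3 Problem 2] -/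
theorem norm_bch3List_sub_sum_le (l : List 𝔸) : ‖bch3List l - l.sum‖ ≤ 2⁻¹ * ns l ^ 2 + 3⁻¹ * ns l ^ 3 := by
  have e : bch3List l - l.sum = (2 : ℂ)⁻¹ • pairBr l + (12 : ℂ)⁻¹ • pairCubic l + (6 : ℂ)⁻¹ • tripleBr l := by
    simp only [bch3List]; abel
  rw [e]
  have h1 : ‖(2 : ℂ)⁻¹ • pairBr l‖ ≤ 2⁻¹ * ns l ^ 2 := by
    rw [norm_inv_smul]; exact mul_le_mul_of_nonneg_left (norm_pairBr_le l) (by norm_num)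
  have h2 : ‖(12 : ℂ)⁻¹ • pairCubic l‖ ≤ 12⁻¹ * (4 / 3 * ns l ^ 3) := by
    rw [norm_inv_smul]; exact mul_le_mul_of_nonneg_left (norm_pairCubic_le l) (by norm_num)
  have h3 : ‖(6 : ℂ)⁻¹ • tripleBr l‖ ≤ 6⁻¹ * (4 / 3 * ns l ^ 3) := by
    rw [norm_inv_smul]; exact mul_le_mul_of_nonneg_left (norm_tripleBr_le l) (by norm_num)
  calc ‖(2 : ℂ)⁻¹ • pairBr l + (12 : ℂ)⁻¹ • pairCubic l + (6 : ℂ)⁻¹ • tripleBr l‖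
      ≤ 2⁻¹ * ns l ^ 2 + 12⁻¹ * (4 / 3 * ns l ^ 3) + 6⁻¹ * (4 / 3 * ns l ^ 3) :=
        (norm_add_le _ _).trans (add_le_add ((norm_add_le _ _).trans (add_le_add h1 h2)) h3)
    _ = 2⁻¹ * ns l ^ 2 + 3⁻¹ * ns l ^ 3 := by ring

/-- The part of degree `≥ 3`: `‖bch3List l − Σl − ½pairBr l‖ ≤ (1/3)ns³`. [cite: Rossmann2002, §1.3 Problem 2] -/
theorem norm_bch3List_sub_sum_sub_pair_le (l : List 𝔸) :
    ‖bch3List l - l.sum - (2 : ℂ)⁻¹ • pairBr l‖ ≤ 3⁻¹ * ns l ^ 3 := by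
  have e : bch3List l - l.sum - (2 : ℂ)⁻¹ • pairBr l = (12 : ℂ)⁻¹ • pairCubic l + (6 : ℂ)⁻¹ • tripleBr l := by
    simp only [bch3List]; abel
  rw [e]
  have h2 : ‖(12 : ℂ)⁻¹ • pairCubic l‖ ≤ 12⁻¹ * (4 / 3 * ns l ^ 3) := by
    rw [norm_inv_smul]; exact mul_le_mul_of_nonneg_left (norm_pairCubic_le l) (by norm_num)
  have h3 : ‖(6 : ℂ)⁻¹ • tripleBr l‖ ≤ 6⁻¹ * (4 / 3 * ns l ^ 3) := by
    rw [norm_inv_smul]; exact mul_le_mul_of_nonneg_left (norm_tripleBr_le l) (by norm_num)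
  calc ‖(12 : ℂ)⁻¹ • pairCubic l + (6 : ℂ)⁻¹ • tripleBr l‖
      ≤ 12⁻¹ * (4 / 3 * ns l ^ 3) + 6⁻¹ * (4 / 3 * ns l ^ 3) := (norm_add_le _ _).trans (add_le_add h2 h3)
    _ = 3⁻¹ * ns l ^ 3 := by ring

/-- `‖bch3List l‖ ≤ 2 ns l` when `ns l ≤ 1`. [cite: Rossmann2002, §1.3 Problem 2] -/
theorem norm_bch3List_le (l : List 𝔸) (h : ns l ≤ 1) : ‖bch3List l‖ ≤ 2 * ns l := by
  have h0 := ns_nonneg l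
  have h1 := norm_bch3List_sub_sum_le l
  have h2 := norm_sum_le_ns l
  have e : bch3List l = (bch3List l - l.sum) + l.sum := by abel
  rw [e]
  refine (norm_add_le _ _).trans ?_
  nlinarith [pow_nonneg h0 2, pow_nonneg h0 3, mul_le_mul_of_nonneg_left h (pow_nonneg h0 2)]

/-- **Size of the junk**: `‖junk a l‖ ≤ (4/3)‖a‖·(‖a‖ + ns l)³` when `‖a‖ + ns l ≤ 1` — LINEAR in the new letter.
[cite: Rossmann2002, §1.3 Problem 2] -/
theorem norm_junk_le (a : 𝔸) (l : List 𝔸) (h : ‖a‖ + ns l ≤ 1) :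
    ‖junk a l‖ ≤ 4 / 3 * ‖a‖ * (‖a‖ + ns l) ^ 3 := by
  have ha := norm_nonneg a
  have h0 := ns_nonneg l
  set σ := ns l with hσ
  set E := bch3List l - l.sum with hE
  set E₃ := bch3List l - l.sum - (2 : ℂ)⁻¹ • pairBr l with hE₃
  have hEle : ‖E‖ ≤ σ ^ 2 := by
    have := norm_bch3List_sub_sum_le l
    nlinarith [pow_nonneg h0 2, pow_nonneg h0 3, mul_le_mul_of_nonneg_left (show σ ≤ 1 by linarith) (pow_nonneg h0 2)]
  have hE3le : ‖E₃‖ ≤ 3⁻¹ * σ ^ 3 := norm_bch3List_sub_sum_sub_pair_le l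
  have hS : ‖l.sum‖ ≤ σ := norm_sum_le_ns l
  have hB : ‖bch3List l‖ ≤ 2 * σ := norm_bch3List_le l (by linarith)
  have t1 : ‖(2 : ℂ)⁻¹ • ⁅a, E₃⁆‖ ≤ ‖a‖ * (3⁻¹ * σ ^ 3) := by
    rw [norm_inv_smul]
    calc (2 : ℝ)⁻¹ * ‖⁅a, E₃⁆‖ ≤ 2⁻¹ * (2 * ‖a‖ * ‖E₃‖) := by gcongr; exact norm_br_le _ _
      _ = ‖a‖ * ‖E₃‖ := by ring
      _ ≤ ‖a‖ * (3⁻¹ * σ ^ 3) := by gcongr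
  have t2 : ‖⁅a, ⁅a, E⁆⁆‖ ≤ 4 * ‖a‖ ^ 2 * σ ^ 2 := by
    calc ‖⁅a, ⁅a, E⁆⁆‖ ≤ 2 * ‖a‖ * ‖⁅a, E⁆‖ := norm_br_le _ _
      _ ≤ 2 * ‖a‖ * (2 * ‖a‖ * σ ^ 2) := by gcongr; exact (norm_br_le _ _).trans (by gcongr)
      _ = 4 * ‖a‖ ^ 2 * σ ^ 2 := by ring
  have t3 : ‖⁅l.sum, ⁅E, a⁆⁆‖ ≤ 4 * σ * σ ^ 2 * ‖a‖ := by
    calc ‖⁅l.sum, ⁅E, a⁆⁆‖ ≤ 2 * ‖l.sum‖ * ‖⁅E, a⁆‖ := norm_br_le _ _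
      _ ≤ 2 * σ * (2 * σ ^ 2 * ‖a‖) := by
        gcongr
        exact (norm_br_le _ _).trans (by gcongr)
      _ = 4 * σ * σ ^ 2 * ‖a‖ := by ring
  have t4 : ‖⁅E, ⁅bch3List l, a⁆⁆‖ ≤ 4 * σ ^ 2 * (2 * σ) * ‖a‖ := by
    calc ‖⁅E, ⁅bch3List l, a⁆⁆‖ ≤ 2 * ‖E‖ * ‖⁅bch3List l, a⁆‖ := norm_br_le _ _
      _ ≤ 2 * σ ^ 2 * (2 * (2 * σ) * ‖a‖) := by
        gcongr
        exact (norm_br_le _ _).trans (by gcongr)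
      _ = 4 * σ ^ 2 * (2 * σ) * ‖a‖ := by ring
  have t5 : ‖(12 : ℂ)⁻¹ • (⁅a, ⁅a, E⁆⁆ + ⁅l.sum, ⁅E, a⁆⁆ + ⁅E, ⁅bch3List l, a⁆⁆)‖ ≤
      12⁻¹ * (4 * ‖a‖ ^ 2 * σ ^ 2 + 4 * σ * σ ^ 2 * ‖a‖ + 4 * σ ^ 2 * (2 * σ) * ‖a‖) := by
    rw [norm_inv_smul]
    gcongr
    exact (norm_add_le _ _).trans (add_le_add ((norm_add_le _ _).trans (add_le_add t2 t3)) t4)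
  calc ‖junk a l‖ ≤ ‖(2 : ℂ)⁻¹ • ⁅a, E₃⁆‖ +
        ‖(12 : ℂ)⁻¹ • (⁅a, ⁅a, E⁆⁆ + ⁅l.sum, ⁅E, a⁆⁆ + ⁅E, ⁅bch3List l, a⁆⁆)‖ := norm_add_le _ _
    _ ≤ ‖a‖ * (3⁻¹ * σ ^ 3) +
        12⁻¹ * (4 * ‖a‖ ^ 2 * σ ^ 2 + 4 * σ * σ ^ 2 * ‖a‖ + 4 * σ ^ 2 * (2 * σ) * ‖a‖) := add_le_add t1 t5
    _ ≤ 4 / 3 * ‖a‖ * (‖a‖ + σ) ^ 3 := by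
        nlinarith [mul_nonneg ha (pow_nonneg h0 3), mul_nonneg (mul_nonneg ha ha) (pow_nonneg h0 2),
          mul_nonneg (pow_nonneg ha 3) h0, pow_nonneg ha 4, mul_nonneg ha (pow_nonneg h0 2)]

variable [CompleteSpace 𝔸]

/-- `‖e^{Y₁}⋯e^{Yₙ} − 1‖ ≤ e^{Σ‖Yᵢ‖} − 1`. [cite: Rossmann2002, §1.3 Theorem 1, remark after (5)] -/
theorem norm_prodExp_sub_one_le (l : List 𝔸) : ‖(l.map exp).prod - 1‖ ≤ Real.exp (ns l) - 1 := by
  induction l with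
  | nil => simp
  | cons a l ih =>
    rw [List.map_cons, List.prod_cons, ns_cons]
    exact norm_mul_sub_one_le_of_le (norm_exp_sub_one_le_exp_norm_sub_one a) ih

/-- `e^{log Π} = Π` for the product of exponentials of a list with `Σ‖Yᵢ‖ < log 2`.
[cite: Rossmann2002, §1.3 (proof of Theorem 1)] -/
theorem exp_log_prodExp (l : List 𝔸) (h : ns l < Real.log 2) :
    exp (logOnePlus ((l.map exp).prod - 1)) = (l.map exp).prod := by
  refine exp_logOnePlus_sub_one ((norm_prodExp_sub_one_le l).trans_lt ?_)
  calc Real.exp (ns l) - 1 < Real.exp (Real.log 2) - 1 := by gcongr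
    _ = 1 := by rw [Real.exp_log two_pos]; norm_num

end Norms

/-! ## §4  The theorem: third-order BCH for a product of exponentials, with an `n`-independent fourth-order tail -/

section Main

variable {𝔸 : Type*} [NormedRing 𝔸] [NormedAlgebra ℂ 𝔸]

/-- Increment of the cubic polynomial in its second argument (exact):
`bch3 a (B + r) − bch3 a B = r + ½[a,r] + (1/12)([a,[a,r]] + [r,[B + r,a]] + [B,[r,a]])`. [cite: Rossmann2002, §1.3 Problem 2] -/
theorem bch3_add_right_sub (a B r : 𝔸) : bch3 a (B + r) - bch3 a B =
    r + (2 : ℂ)⁻¹ • ⁅a, r⁆ + (12 : ℂ)⁻¹ • (⁅a, ⁅a, r⁆⁆ + ⁅r, ⁅B + r, a⁆⁆ + ⁅B, ⁅r, a⁆⁆) := by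
  simp only [bch3, Ring.lie_def]
  simp only [mul_sub, sub_mul, mul_add, add_mul, mul_assoc, smul_sub, smul_add]
  module

/-- `‖bch3 a (B + r) − bch3 a B‖ ≤ (1 + 2‖a‖)‖r‖` when `‖a‖ + ‖B + r‖ + ‖B‖ ≤ 3` — Lipschitz in the second argument with
a constant close to `1`. [cite: Rossmann2002, §1.3 Problem 2] -/
theorem norm_bch3_sub_bch3_le (a B r : 𝔸) (h : ‖a‖ + ‖B + r‖ + ‖B‖ ≤ 3) :
    ‖bch3 a (B + r) - bch3 a B‖ ≤ (1 + 2 * ‖a‖) * ‖r‖ := by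
  rw [bch3_add_right_sub]
  have ha := norm_nonneg a
  have hr := norm_nonneg r
  have hB := norm_nonneg B
  have hW := norm_nonneg (B + r)
  have t1 : ‖(2 : ℂ)⁻¹ • ⁅a, r⁆‖ ≤ ‖a‖ * ‖r‖ := by
    rw [norm_inv_smul]
    calc (2 : ℝ)⁻¹ * ‖⁅a, r⁆‖ ≤ 2⁻¹ * (2 * ‖a‖ * ‖r‖) := by gcongr; exact norm_br_le _ _
      _ = ‖a‖ * ‖r‖ := by ring
  have t2 : ‖⁅a, ⁅a, r⁆⁆‖ ≤ 2 * ‖a‖ * (2 * ‖a‖ * ‖r‖) :=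
    (norm_br_le _ _).trans (by gcongr; exact norm_br_le _ _)
  have t3 : ‖⁅r, ⁅B + r, a⁆⁆‖ ≤ 2 * ‖r‖ * (2 * ‖B + r‖ * ‖a‖) :=
    (norm_br_le _ _).trans (by gcongr; exact norm_br_le _ _)
  have t4 : ‖⁅B, ⁅r, a⁆⁆‖ ≤ 2 * ‖B‖ * (2 * ‖r‖ * ‖a‖) :=
    (norm_br_le _ _).trans (by gcongr; exact norm_br_le _ _)
  have t5 : ‖(12 : ℂ)⁻¹ • (⁅a, ⁅a, r⁆⁆ + ⁅r, ⁅B + r, a⁆⁆ + ⁅B, ⁅r, a⁆⁆)‖ ≤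
      12⁻¹ * (2 * ‖a‖ * (2 * ‖a‖ * ‖r‖) + 2 * ‖r‖ * (2 * ‖B + r‖ * ‖a‖) + 2 * ‖B‖ * (2 * ‖r‖ * ‖a‖)) := by
    rw [norm_inv_smul]
    gcongr
    exact (norm_add_le _ _).trans (add_le_add ((norm_add_le _ _).trans (add_le_add t2 t3)) t4)
  calc ‖r + (2 : ℂ)⁻¹ • ⁅a, r⁆ + (12 : ℂ)⁻¹ • (⁅a, ⁅a, r⁆⁆ + ⁅r, ⁅B + r, a⁆⁆ + ⁅B, ⁅r, a⁆⁆)‖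
      ≤ ‖r‖ + ‖a‖ * ‖r‖ +
        12⁻¹ * (2 * ‖a‖ * (2 * ‖a‖ * ‖r‖) + 2 * ‖r‖ * (2 * ‖B + r‖ * ‖a‖) + 2 * ‖B‖ * (2 * ‖r‖ * ‖a‖)) :=
        (norm_add_le _ _).trans (add_le_add ((norm_add_le _ _).trans (add_le_add le_rfl t1)) t5)
    _ = ‖r‖ * (1 + ‖a‖ + 3⁻¹ * ‖a‖ * (‖a‖ + ‖B + r‖ + ‖B‖)) := by ring
    _ ≤ ‖r‖ * (1 + ‖a‖ + 3⁻¹ * ‖a‖ * 3) := by gcongr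
    _ = (1 + 2 * ‖a‖) * ‖r‖ := by ring

/-- Numerics: for `0 ≤ σ ≤ 1/10`, `e^σ − 1 ≤ σ + σ² ≤ 11/100`. [cite: Rossmann2002, §1.3 Theorem 1, remark after (5)] -/
theorem exp_sub_one_le_of_le_tenth {σ : ℝ} (h0 : 0 ≤ σ) (h1 : σ ≤ 1 / 10) :
    Real.exp σ - 1 ≤ σ + σ ^ 2 := by
  have h := Real.abs_exp_sub_one_sub_id_le (x := σ) (by rw [abs_of_nonneg h0]; linarith)
  rw [abs_le] at h
  linarith [h.2]

/-- Numerics: `x/(1 − x) ≤ (5/4)σ` for `0 ≤ x ≤ σ + σ²`, `0 ≤ σ ≤ 1/10` (the size of `log` of a product whose distance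
to `1` is at most `e^σ − 1`). [cite: Rossmann2002, §1.3 Theorem 1, remark after (5)] -/
theorem div_one_sub_le_of_le_tenth {x σ : ℝ} (hx0 : 0 ≤ x) (hx : x ≤ σ + σ ^ 2) (h0 : 0 ≤ σ) (h1 : σ ≤ 1 / 10) :
    x / (1 - x) ≤ 5 / 4 * σ := by
  have hσ2 : σ ^ 2 ≤ σ / 10 := by nlinarith
  have hx1 : x ≤ 11 / 100 := by nlinarith
  rw [div_le_iff₀ (by linarith)]
  nlinarith [mul_nonneg h0 hx0]

variable [CompleteSpace 𝔸]

/-- **THIRD-ORDER BAKER–CAMPBELL–HAUSDORFF FOR A PRODUCT OF EXPONENTIALS, WITH REMAINDER** (sharp-in-shape form):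
for an ordered list `Y₁,…,Yₙ` in a complete normed `ℂ`-algebra with `s = Σ‖Yᵢ‖ ≤ 1/10`,
`‖log(e^{Y₁}⋯e^{Yₙ}) − bch3List [Y₁,…,Yₙ]‖ ≤ 23440·e^{2s}·s⁴`, UNIFORMLY IN `n`.
Induction on the list: `log(e^{a}·Π) = log(e^{a}e^{W})`, `W = log Π = bch3List l + r`; the new two-factor tail is
`≤ 12000‖a‖(‖a‖+‖W‖)³` (§1, `‖W‖ ≤ (5/4)Σ‖Yᵢ‖`), the increment `bch3 a W − bch3 a (bch3List l)` is `≤ (1+2‖a‖)‖r‖`,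
and the algebra is exact up to `junk a l`, `‖junk‖ ≤ (4/3)‖a‖s³` (§2–§3); `1 + 2‖a‖ ≤ e^{2‖a‖}` closes the induction.
[cite: Balaban1985Variational, (34) p.283] [cite: Rossmann2002, §1.3 Theorem 1 (4), Problem 2] -/
theorem norm_log_prodExp_sub_bch3List_le_exp (l : List 𝔸) (h : ns l ≤ 1 / 10) :
    ‖logOnePlus ((l.map exp).prod - 1) - bch3List l‖ ≤ 23440 * Real.exp (2 * ns l) * ns l ^ 4 := by
  induction l with
  | nil => simp
  | cons a t ih =>
    rw [ns_cons] at h ⊢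
    have ha := norm_nonneg a
    have hσ0 := ns_nonneg t
    have hσ : ns t ≤ 1 / 10 := by linarith
    have iht := ih hσ
    set σ := ns t with hσdef
    set α := ‖a‖ with hαdef
    -- the product of the tail and its logarithm
    set P := (t.map exp).prod with hP
    have hP1 : ‖P - 1‖ ≤ Real.exp σ - 1 := norm_prodExp_sub_one_le t
    have hPσ : ‖P - 1‖ ≤ σ + σ ^ 2 := hP1.trans (exp_sub_one_le_of_le_tenth hσ0 hσ)
    have hPlt : ‖P - 1‖ < 1 := by nlinarith
    set W := logOnePlus (P - 1) with hW
    have hexpW : exp W = P := exp_logOnePlus_sub_one hPlt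
    have hWle : ‖W‖ ≤ 5 / 4 * σ :=
      (norm_logOnePlus_le hPlt).trans (div_one_sub_le_of_le_tenth (norm_nonneg _) hPσ hσ0 hσ)
    set B := bch3List t with hB
    set r := W - B with hr
    have hWBr : W = B + r := by rw [hr]; abel
    have hrle : ‖r‖ ≤ 23440 * Real.exp (2 * σ) * σ ^ 4 := iht
    -- the decomposition of the new remainder
    have hprod : ((a :: t).map exp).prod = exp a * exp W := by
      rw [List.map_cons, List.prod_cons, hexpW]
    have hdec : logOnePlus (((a :: t).map exp).prod - 1) - bch3List (a :: t) =
        (logOnePlus (exp a * exp W - 1) - bch3 a W) + (bch3 a (B + r) - bch3 a B) + junk a t := by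
      rw [hprod, ← hWBr, hB, bch3_cons a t]; abel
    rw [hdec]
    -- the three sizes
    have hs1 : α + ‖W‖ ≤ 3 / 20 := by linarith
    have T1 : ‖logOnePlus (exp a * exp W - 1) - bch3 a W‖ ≤ 12000 * α * (5 / 4 * (α + σ)) ^ 3 := by
      refine (norm_logOnePlus_sub_bch3_le_mul a W hs1).trans ?_
      have : α + ‖W‖ ≤ 5 / 4 * (α + σ) := by linarith
      gcongr
    have hBle : ‖B‖ ≤ 2 * σ := norm_bch3List_le t (by linarith)
    have T2 : ‖bch3 a (B + r) - bch3 a B‖ ≤ (1 + 2 * α) * ‖r‖ :=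
      norm_bch3_sub_bch3_le a B r (by rw [← hWBr]; linarith)
    have T3 : ‖junk a t‖ ≤ 4 / 3 * α * (α + σ) ^ 3 := norm_junk_le a t (by linarith)
    -- assembling
    have hexp2 : 1 + 2 * α ≤ Real.exp (2 * α) := by linarith [Real.add_one_le_exp (2 * α)]
    have hexpmul : Real.exp (2 * α) * Real.exp (2 * σ) = Real.exp (2 * (α + σ)) := by
      rw [← Real.exp_add]; ring_nf
    have hE1 : 1 ≤ Real.exp (2 * (α + σ)) := Real.one_le_exp (by positivity)
    have hEσ := Real.exp_pos (2 * σ)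
    set s := α + σ with hs
    have hσs : σ ≤ s := by linarith
    have hs0 : 0 ≤ s := by linarith
    have key1 : (1 + 2 * α) * ‖r‖ ≤ 23440 * Real.exp (2 * s) * σ ^ 4 := by
      calc (1 + 2 * α) * ‖r‖ ≤ Real.exp (2 * α) * (23440 * Real.exp (2 * σ) * σ ^ 4) :=
            mul_le_mul hexp2 hrle (norm_nonneg _) (Real.exp_pos _).le
        _ = 23440 * (Real.exp (2 * α) * Real.exp (2 * σ)) * σ ^ 4 := by ring
        _ = 23440 * Real.exp (2 * s) * σ ^ 4 := by rw [hexpmul]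
    have key2 : 12000 * α * (5 / 4 * s) ^ 3 + 4 / 3 * α * s ^ 3 ≤ 23440 * Real.exp (2 * s) * (α * s ^ 3) := by
      have h3 : 0 ≤ α * s ^ 3 := by positivity
      calc 12000 * α * (5 / 4 * s) ^ 3 + 4 / 3 * α * s ^ 3 = (23437.5 + 4 / 3) * (α * s ^ 3) := by ring
        _ ≤ 23440 * 1 * (α * s ^ 3) := by gcongr; norm_num
        _ ≤ 23440 * Real.exp (2 * s) * (α * s ^ 3) := by gcongr
    have key3 : σ ^ 4 + α * s ^ 3 ≤ s ^ 4 := by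
      have : σ ^ 4 ≤ σ * s ^ 3 := by
        calc σ ^ 4 = σ * σ ^ 3 := by ring
          _ ≤ σ * s ^ 3 := by gcongr
      nlinarith
    calc ‖logOnePlus (exp a * exp W - 1) - bch3 a W + (bch3 a (B + r) - bch3 a B) + junk a t‖
        ≤ ‖logOnePlus (exp a * exp W - 1) - bch3 a W‖ + ‖bch3 a (B + r) - bch3 a B‖ + ‖junk a t‖ :=
          norm_add₃_le
      _ ≤ 12000 * α * (5 / 4 * s) ^ 3 + (1 + 2 * α) * ‖r‖ + 4 / 3 * α * s ^ 3 := add_le_add (add_le_add T1 T2) T3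
      _ ≤ 23440 * Real.exp (2 * s) * (α * s ^ 3) + 23440 * Real.exp (2 * s) * σ ^ 4 := by linarith
      _ = 23440 * Real.exp (2 * s) * (σ ^ 4 + α * s ^ 3) := by ring
      _ ≤ 23440 * Real.exp (2 * s) * s ^ 4 := by gcongr

/-- **THIRD-ORDER BAKER–CAMPBELL–HAUSDORFF FOR A PRODUCT OF EXPONENTIALS, WITH REMAINDER**: for an ordered list
`Y₁,…,Yₙ` in a complete normed `ℂ`-algebra with `Σ‖Yᵢ‖ ≤ 1/10`,
`‖log(e^{Y₁}⋯e^{Yₙ}) − (ΣYᵢ + ½Σ_{i<j}[Yᵢ,Yⱼ] + (1/12)Σ_{i<j}([Yᵢ,[Yᵢ,Yⱼ]]+[[Yᵢ,Yⱼ],Yⱼ]) + (1/6)Σ_{i<j<k}([Yᵢ,[Yⱼ,Yₖ]]+[[Yᵢ,Yⱼ],Yₖ]))‖`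
`≤ 30000·(Σ‖Yᵢ‖)⁴` — the «`+ …`» of (34), with a constant independent of the number of factors.
[cite: Balaban1985Variational, (34) p.283] [cite: Rossmann2002, §1.3 Theorem 1 (4), Problem 2] -/
theorem norm_log_prodExp_sub_bch3List_le (l : List 𝔸) (h : ns l ≤ 1 / 10) :
    ‖logOnePlus ((l.map exp).prod - 1) - bch3List l‖ ≤ 30000 * ns l ^ 4 := by
  have h0 := ns_nonneg l
  have he : Real.exp (2 * ns l) ≤ 1.24 := by
    have hb := Real.abs_exp_sub_one_sub_id_le (x := 2 * ns l) (by rw [abs_of_nonneg (by positivity)]; linarith)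
    rw [abs_le] at hb
    nlinarith [hb.2]
  calc ‖logOnePlus ((l.map exp).prod - 1) - bch3List l‖ ≤ 23440 * Real.exp (2 * ns l) * ns l ^ 4 :=
        norm_log_prodExp_sub_bch3List_le_exp l h
    _ ≤ 23440 * 1.24 * ns l ^ 4 := by gcongr
    _ ≤ 30000 * ns l ^ 4 := by nlinarith [pow_nonneg h0 4]

/-- **The product as ONE exponential**: `e^{Y₁}⋯e^{Yₙ} = exp(bch3List [Y₁,…,Yₙ] + R)` with `‖R‖ ≤ 30000(Σ‖Yᵢ‖)⁴`
(`R = log Π − bch3List`), for `Σ‖Yᵢ‖ ≤ 1/10` — the shape of (34). [cite: Balaban1985Variational, (34) p.283] -/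
theorem prodExp_eq_exp_bch3List_add (l : List 𝔸) (h : ns l ≤ 1 / 10) :
    ∃ R : 𝔸, (l.map exp).prod = exp (bch3List l + R) ∧ ‖R‖ ≤ 30000 * ns l ^ 4 := by
  refine ⟨logOnePlus ((l.map exp).prod - 1) - bch3List l, ?_, norm_log_prodExp_sub_bch3List_le l h⟩
  rw [add_sub_cancel, exp_log_prodExp l (lt_of_le_of_lt h (by linarith [one_fifth_lt_log_two]))]

/-- Four factors, written out (the case of (34): the four bonds of a plaquette): for `‖a‖+‖b‖+‖c‖+‖d‖ ≤ 1/10`,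
`‖log(e^a e^b e^c e^d) − bch3List [a,b,c,d]‖ ≤ 30000(‖a‖+‖b‖+‖c‖+‖d‖)⁴` with `bch3List [a,b,c,d]` as in `bch3List_four`.
[cite: Balaban1985Variational, (34) p.283] -/
theorem norm_log_prodExp_four_sub_le (a b c d : 𝔸) (h : ‖a‖ + ‖b‖ + ‖c‖ + ‖d‖ ≤ 1 / 10) :
    ‖logOnePlus (exp a * exp b * exp c * exp d - 1) - bch3List [a, b, c, d]‖ ≤
      30000 * (‖a‖ + ‖b‖ + ‖c‖ + ‖d‖) ^ 4 := by
  have hns : ns [a, b, c, d] = ‖a‖ + ‖b‖ + ‖c‖ + ‖d‖ := by simp [add_assoc]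
  have hprod : ([a, b, c, d].map exp).prod = exp a * exp b * exp c * exp d := by simp [mul_assoc]
  have := norm_log_prodExp_sub_bch3List_le [a, b, c, d] (by rw [hns]; exact h)
  rwa [hns, hprod] at this

end Main

/-! ## §5  Print's regime: the same theorem up to `Σ‖Yᵢ‖ ≤ 1/8` (v1.1)

In [Balaban1985Variational] the letters `Yᵢ = iηA′(bᵢ)` of (34) live in the regime (32) with «for simplicity
`32ε₂ ≤ 1`», which the line before (33) turns into `e^{η|A|(∂p)} < e^{4ε₂} < 2`, i.e. `Σ_{b⊂∂p} η|A′(b)| < 4ε₂ ≤ 1/8`.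
§4's threshold `1/10` is re-tuned here to exactly `1/8`, at the price of the constant (`40000` for `30000`): the
Schwarz step of §1 is made PARAMETRIC in the auxiliary radius (`norm_logOnePlus_sub_bch3_le_schwarz`); at the ratio
`6/5` it gives the two-factor tail `≤ 12960‖X‖(‖X‖+‖Y‖)³` up to `‖X‖ + ‖Y‖ ≤ 1/6`, and the list induction of §4 runs
with `‖log Π‖ ≤ (4/3)Σ‖Yᵢ‖` (valid up to `1/8`; `(4/3)·(1/8) = 1/6`), giving
`‖log(e^{Y₁}⋯e^{Yₙ}) − bch3List [Y₁,…,Yₙ]‖ ≤ 30722·e^{2s}·s⁴ ≤ 40000·s⁴` for `s = Σ‖Yᵢ‖ ≤ 1/8`, uniformly in `n`. -/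

section Eighth

variable {𝔸 : Type*} [NormedRing 𝔸] [NormedAlgebra ℂ 𝔸] [CompleteSpace 𝔸]

/-- **Schwarz form of the two-factor tail, parametric in the auxiliary radius**: for any `σ` with
`‖X‖ + ‖Y‖ < σ ≤ 1/5`, `‖log(e^X e^Y) − bch3 X Y‖ ≤ 1250σ⁴·‖X‖/(σ − ‖Y‖)`
(`f(t) = log(e^{tX}e^Y) − bch3 (tX) Y` is holomorphic and bounded by `1250σ⁴` on `|t| < (σ − ‖Y‖)/‖X‖`, `f(0) = 0`).
[cite: Rossmann2002, §1.3 Theorem 1 (4), remark after (5), Problem 2] -/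
theorem norm_logOnePlus_sub_bch3_le_schwarz (X Y : 𝔸) {σ : ℝ} (hσ : ‖X‖ + ‖Y‖ < σ) (hσ5 : σ ≤ 1 / 5) :
    ‖logOnePlus (exp X * exp Y - 1) - bch3 X Y‖ ≤ 1250 * σ ^ 4 * ‖X‖ / (σ - ‖Y‖) := by
  have hlog2 := one_fifth_lt_log_two
  rcases eq_or_ne X 0 with rfl | hX0
  · have hY : ‖Y‖ < Real.log 2 := by rw [norm_zero, zero_add] at hσ; linarith
    simp [logOnePlus_exp_sub_one hY]
  set a : ℝ := ‖X‖ with ha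
  set b : ℝ := ‖Y‖ with hb
  have ha0 : 0 < a := norm_pos_iff.mpr hX0
  have hb0 : 0 ≤ b := norm_nonneg Y
  set R₁ : ℝ := (σ - b) / a with hR₁
  have hR₁a : R₁ * a = σ - b := by rw [hR₁, div_mul_cancel₀ _ ha0.ne']
  have hR₁1 : 1 < R₁ := by rw [hR₁, lt_div_iff₀ ha0]; linarith
  have hR₁0 : 0 < R₁ := by linarith
  set f : ℂ → 𝔸 := fun t => logOnePlus (exp (t • X) * exp Y - 1) - bch3 (t • X) Y with hf
  have hY2 : ‖Y‖ < Real.log 2 := by linarith [ha0.le, norm_nonneg X]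
  have hf0 : f 0 = 0 := by simp [hf, logOnePlus_exp_sub_one hY2]
  -- sizes on the disc
  have hsum : ∀ t ∈ ball (0 : ℂ) R₁, ‖t • X‖ + ‖Y‖ < σ := by
    intro t ht
    rw [mem_ball_zero_iff] at ht
    rw [norm_smul]
    calc ‖t‖ * ‖X‖ + ‖Y‖ < R₁ * a + b := by rw [← ha, ← hb]; gcongr
      _ = σ := by rw [hR₁a]; ring
  have hlt : ∀ t ∈ ball (0 : ℂ) R₁, ‖exp (t • X) * exp Y - 1‖ < 1 := by
    intro t ht
    calc ‖exp (t • X) * exp Y - 1‖ ≤ Real.exp (‖t • X‖ + ‖Y‖) - 1 :=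
          norm_mul_sub_one_le_of_le (norm_exp_sub_one_le_exp_norm_sub_one _)
            (norm_exp_sub_one_le_exp_norm_sub_one _)
      _ < Real.exp (Real.log 2) - 1 := by gcongr; linarith [hsum t ht, hσ5, hlog2]
      _ = 1 := by rw [Real.exp_log two_pos]; norm_num
  have hdiff : DifferentiableOn ℂ f (ball (0 : ℂ) R₁) := by
    refine DifferentiableOn.sub ?_ (differentiable_bch3_smul_left X Y).differentiableOn
    exact Literature.Analysis.Complex.differentiableOn_logOnePlus_comp
      (((differentiable_exp_smul_const ℂ X).mul_const (exp Y)).sub_const 1).differentiableOn hlt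
  have hmaps : MapsTo f (ball (0 : ℂ) R₁) (closedBall (f 0) (1250 * σ ^ 4)) := by
    intro t ht
    rw [hf0, mem_closedBall_zero_iff]
    have hs := hsum t ht
    calc ‖f t‖ ≤ 1250 * (‖t • X‖ + ‖Y‖) ^ 4 := norm_logOnePlus_sub_bch3_le _ _ (by linarith)
      _ ≤ 1250 * σ ^ 4 := by gcongr
  have h1 : (1 : ℂ) ∈ ball (0 : ℂ) R₁ := by simpa using hR₁1
  have hS := Complex.dist_le_div_mul_dist_of_mapsTo_ball hdiff hmaps h1
  rw [hf0, dist_zero_right, dist_zero_right, norm_one, mul_one] at hS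
  have hf1 : f 1 = logOnePlus (exp X * exp Y - 1) - bch3 X Y := by simp [hf]
  rw [hf1] at hS
  refine hS.trans (le_of_eq ?_)
  rw [hR₁, div_div_eq_mul_div]

/-- **The two-factor tail up to `‖X‖ + ‖Y‖ ≤ 1/6`** (ratio `6/5` in the Schwarz step):
`‖log(e^X e^Y) − bch3 X Y‖ ≤ 12960·‖X‖·(‖X‖ + ‖Y‖)³`. [cite: Rossmann2002, §1.3 Theorem 1 (4), Problem 2] -/
theorem norm_logOnePlus_sub_bch3_le_mul_sixth (X Y : 𝔸) (h : ‖X‖ + ‖Y‖ ≤ 1 / 6) :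
    ‖logOnePlus (exp X * exp Y - 1) - bch3 X Y‖ ≤ 12960 * ‖X‖ * (‖X‖ + ‖Y‖) ^ 3 := by
  rcases eq_or_ne X 0 with rfl | hX0
  · have hY : ‖Y‖ < Real.log 2 := by rw [norm_zero, zero_add] at h; linarith [one_fifth_lt_log_two]
    simp [logOnePlus_exp_sub_one hY]
  have ha0 : 0 < ‖X‖ := norm_pos_iff.mpr hX0
  have hb0 : 0 ≤ ‖Y‖ := norm_nonneg Y
  have hS := norm_logOnePlus_sub_bch3_le_schwarz X Y (σ := 6 / 5 * (‖X‖ + ‖Y‖)) (by linarith) (by linarith)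
  refine hS.trans ?_
  rw [div_le_iff₀ (by linarith)]
  set a := ‖X‖
  set b := ‖Y‖
  have e1 : 1250 * (6 / 5 * (a + b)) ^ 4 * a = 2592 * ((a + b) ^ 3 * a) * (a + b) := by ring
  have e2 : 12960 * a * (a + b) ^ 3 * (6 / 5 * (a + b) - b) = 2592 * ((a + b) ^ 3 * a) * (6 * a + b) := by ring
  rw [e1, e2]
  have h3 : 0 ≤ (a + b) ^ 3 * a := by positivity
  gcongr
  linarith

omit [CompleteSpace 𝔸] in
/-- Numerics: for `0 ≤ σ ≤ 1`, `e^σ − 1 ≤ σ + σ²`. [cite: Rossmann2002, §1.3 Theorem 1, remark after (5)] -/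
theorem exp_sub_one_le_add_sq {σ : ℝ} (h0 : 0 ≤ σ) (h1 : σ ≤ 1) : Real.exp σ - 1 ≤ σ + σ ^ 2 := by
  have h := Real.abs_exp_sub_one_sub_id_le (x := σ) (by rwa [abs_of_nonneg h0])
  rw [abs_le] at h
  linarith [h.2]

omit [CompleteSpace 𝔸] in
/-- Numerics: `x/(1 − x) ≤ (4/3)σ` for `x ≤ σ + σ²`, `0 ≤ σ ≤ 1/8` (`7σ + 4σ² ≤ 1` at `σ = 1/8`).
[cite: Rossmann2002, §1.3 Theorem 1, remark after (5)] -/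
theorem div_one_sub_le_of_le_eighth {x σ : ℝ} (hx : x ≤ σ + σ ^ 2) (h0 : 0 ≤ σ) (h1 : σ ≤ 1 / 8) :
    x / (1 - x) ≤ 4 / 3 * σ := by
  have hσ2 : σ ^ 2 ≤ σ / 8 := by nlinarith
  have hσ3 : σ ^ 3 ≤ σ ^ 2 / 8 := by nlinarith
  have hx1 : x ≤ 9 / 64 := by nlinarith
  have hσx : σ * x ≤ σ ^ 2 + σ ^ 3 := by nlinarith [mul_nonneg h0 (sub_nonneg.2 hx)]
  rw [div_le_iff₀ (by linarith)]
  nlinarith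

/-- **THIRD-ORDER BCH FOR A PRODUCT OF EXPONENTIALS, PRINT'S REGIME** (sharp-in-shape form): for an ordered list
`Y₁,…,Yₙ` with `s = Σ‖Yᵢ‖ ≤ 1/8`, `‖log(e^{Y₁}⋯e^{Yₙ}) − bch3List [Y₁,…,Yₙ]‖ ≤ 30722·e^{2s}·s⁴`, UNIFORMLY IN `n`
(the induction of `norm_log_prodExp_sub_bch3List_le_exp` with `norm_logOnePlus_sub_bch3_le_mul_sixth` and
`‖log Π‖ ≤ (4/3)Σ‖Yᵢ‖`; `12960·(4/3)³ + 4/3 ≤ 30722`).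
[cite: Balaban1985Variational, (32)–(34) pp.282–283] [cite: Rossmann2002, §1.3 Theorem 1 (4), Problem 2] -/
theorem norm_log_prodExp_sub_bch3List_le_exp_eighth (l : List 𝔸) (h : ns l ≤ 1 / 8) :
    ‖logOnePlus ((l.map exp).prod - 1) - bch3List l‖ ≤ 30722 * Real.exp (2 * ns l) * ns l ^ 4 := by
  induction l with
  | nil => simp
  | cons a t ih =>
    rw [ns_cons] at h ⊢
    have ha := norm_nonneg a
    have hσ0 := ns_nonneg t
    have hσ : ns t ≤ 1 / 8 := by linarith
    have iht := ih hσ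
    set σ := ns t with hσdef
    set α := ‖a‖ with hαdef
    -- the product of the tail and its logarithm
    set P := (t.map exp).prod with hP
    have hP1 : ‖P - 1‖ ≤ Real.exp σ - 1 := norm_prodExp_sub_one_le t
    have hPσ : ‖P - 1‖ ≤ σ + σ ^ 2 := hP1.trans (exp_sub_one_le_add_sq hσ0 (by linarith))
    have hPlt : ‖P - 1‖ < 1 := by nlinarith
    set W := logOnePlus (P - 1) with hW
    have hexpW : exp W = P := exp_logOnePlus_sub_one hPlt
    have hWle : ‖W‖ ≤ 4 / 3 * σ :=
      (norm_logOnePlus_le hPlt).trans (div_one_sub_le_of_le_eighth hPσ hσ0 hσ)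
    set B := bch3List t with hB
    set r := W - B with hr
    have hWBr : W = B + r := by rw [hr]; abel
    have hrle : ‖r‖ ≤ 30722 * Real.exp (2 * σ) * σ ^ 4 := iht
    -- the decomposition of the new remainder
    have hprod : ((a :: t).map exp).prod = exp a * exp W := by
      rw [List.map_cons, List.prod_cons, hexpW]
    have hdec : logOnePlus (((a :: t).map exp).prod - 1) - bch3List (a :: t) =
        (logOnePlus (exp a * exp W - 1) - bch3 a W) + (bch3 a (B + r) - bch3 a B) + junk a t := by
      rw [hprod, ← hWBr, hB, bch3_cons a t]; abel
    rw [hdec]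
    -- the three sizes
    have hs1 : α + ‖W‖ ≤ 1 / 6 := by linarith
    have T1 : ‖logOnePlus (exp a * exp W - 1) - bch3 a W‖ ≤ 12960 * α * (4 / 3 * (α + σ)) ^ 3 := by
      refine (norm_logOnePlus_sub_bch3_le_mul_sixth a W hs1).trans ?_
      have : α + ‖W‖ ≤ 4 / 3 * (α + σ) := by linarith
      gcongr
    have hBle : ‖B‖ ≤ 2 * σ := norm_bch3List_le t (by linarith)
    have T2 : ‖bch3 a (B + r) - bch3 a B‖ ≤ (1 + 2 * α) * ‖r‖ :=
      norm_bch3_sub_bch3_le a B r (by rw [← hWBr]; linarith)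
    have T3 : ‖junk a t‖ ≤ 4 / 3 * α * (α + σ) ^ 3 := norm_junk_le a t (by linarith)
    -- assembling
    have hexp2 : 1 + 2 * α ≤ Real.exp (2 * α) := by linarith [Real.add_one_le_exp (2 * α)]
    have hexpmul : Real.exp (2 * α) * Real.exp (2 * σ) = Real.exp (2 * (α + σ)) := by
      rw [← Real.exp_add]; ring_nf
    have hE1 : 1 ≤ Real.exp (2 * (α + σ)) := Real.one_le_exp (by positivity)
    have hEσ := Real.exp_pos (2 * σ)
    set s := α + σ with hs
    have hσs : σ ≤ s := by linarith
    have hs0 : 0 ≤ s := by linarith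
    have key1 : (1 + 2 * α) * ‖r‖ ≤ 30722 * Real.exp (2 * s) * σ ^ 4 := by
      calc (1 + 2 * α) * ‖r‖ ≤ Real.exp (2 * α) * (30722 * Real.exp (2 * σ) * σ ^ 4) :=
            mul_le_mul hexp2 hrle (norm_nonneg _) (Real.exp_pos _).le
        _ = 30722 * (Real.exp (2 * α) * Real.exp (2 * σ)) * σ ^ 4 := by ring
        _ = 30722 * Real.exp (2 * s) * σ ^ 4 := by rw [hexpmul]
    have key2 : 12960 * α * (4 / 3 * s) ^ 3 + 4 / 3 * α * s ^ 3 ≤ 30722 * Real.exp (2 * s) * (α * s ^ 3) := by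
      have h3 : 0 ≤ α * s ^ 3 := by positivity
      calc 12960 * α * (4 / 3 * s) ^ 3 + 4 / 3 * α * s ^ 3 = (30720 + 4 / 3) * (α * s ^ 3) := by ring
        _ ≤ 30722 * 1 * (α * s ^ 3) := by gcongr; norm_num
        _ ≤ 30722 * Real.exp (2 * s) * (α * s ^ 3) := by gcongr
    have key3 : σ ^ 4 + α * s ^ 3 ≤ s ^ 4 := by
      have : σ ^ 4 ≤ σ * s ^ 3 := by
        calc σ ^ 4 = σ * σ ^ 3 := by ring
          _ ≤ σ * s ^ 3 := by gcongr
      nlinarith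
    calc ‖logOnePlus (exp a * exp W - 1) - bch3 a W + (bch3 a (B + r) - bch3 a B) + junk a t‖
        ≤ ‖logOnePlus (exp a * exp W - 1) - bch3 a W‖ + ‖bch3 a (B + r) - bch3 a B‖ + ‖junk a t‖ :=
          norm_add₃_le
      _ ≤ 12960 * α * (4 / 3 * s) ^ 3 + (1 + 2 * α) * ‖r‖ + 4 / 3 * α * s ^ 3 := add_le_add (add_le_add T1 T2) T3
      _ ≤ 30722 * Real.exp (2 * s) * (α * s ^ 3) + 30722 * Real.exp (2 * s) * σ ^ 4 := by linarith
      _ = 30722 * Real.exp (2 * s) * (σ ^ 4 + α * s ^ 3) := by ring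
      _ ≤ 30722 * Real.exp (2 * s) * s ^ 4 := by gcongr

omit [CompleteSpace 𝔸] in
/-- Numerics: `e^{1/4} ≤ 1.3` (`1.3⁴ = 2.8561 > e`). [cite: Rossmann2002, §1.3 Theorem 1, remark after (5)] -/
theorem exp_quarter_le : Real.exp (1 / 4) ≤ 1.3 := by
  refine not_lt.mp fun hlt => ?_
  have hp := pow_lt_pow_left₀ hlt (by norm_num) four_ne_zero
  rw [← Real.exp_nat_mul] at hp
  norm_num at hp
  linarith [Real.exp_one_lt_d9]

/-- **THIRD-ORDER BAKER–CAMPBELL–HAUSDORFF FOR A PRODUCT OF EXPONENTIALS, WITH REMAINDER, IN PRINT'S REGIME**: for an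
ordered list `Y₁,…,Yₙ` in a complete normed `ℂ`-algebra with `Σ‖Yᵢ‖ ≤ 1/8` (print: `Σ_b η|A′(b)| < 4ε₂`, `32ε₂ ≤ 1`),
`‖log(e^{Y₁}⋯e^{Yₙ}) − (ΣYᵢ + ½Σ_{i<j}[Yᵢ,Yⱼ] + (1/12)Σ_{i<j}([Yᵢ,[Yᵢ,Yⱼ]]+[[Yᵢ,Yⱼ],Yⱼ]) + (1/6)Σ_{i<j<k}([Yᵢ,[Yⱼ,Yₖ]]+[[Yᵢ,Yⱼ],Yₖ]))‖`
`≤ 40000·(Σ‖Yᵢ‖)⁴`, the constant independent of the number of factors.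
[cite: Balaban1985Variational, (32)–(34) pp.282–283] [cite: Rossmann2002, §1.3 Theorem 1 (4), Problem 2] -/
theorem norm_log_prodExp_sub_bch3List_le_eighth (l : List 𝔸) (h : ns l ≤ 1 / 8) :
    ‖logOnePlus ((l.map exp).prod - 1) - bch3List l‖ ≤ 40000 * ns l ^ 4 := by
  have h0 := ns_nonneg l
  have he : Real.exp (2 * ns l) ≤ 1.3 := (Real.exp_le_exp.2 (by linarith)).trans exp_quarter_le
  calc ‖logOnePlus ((l.map exp).prod - 1) - bch3List l‖ ≤ 30722 * Real.exp (2 * ns l) * ns l ^ 4 :=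
        norm_log_prodExp_sub_bch3List_le_exp_eighth l h
    _ ≤ 30722 * 1.3 * ns l ^ 4 := by gcongr
    _ ≤ 40000 * ns l ^ 4 := by nlinarith [pow_nonneg h0 4]

/-- **The product as ONE exponential, print's regime**: `e^{Y₁}⋯e^{Yₙ} = exp(bch3List [Y₁,…,Yₙ] + R)` with
`‖R‖ ≤ 40000(Σ‖Yᵢ‖)⁴`, for `Σ‖Yᵢ‖ ≤ 1/8`. [cite: Balaban1985Variational, (32)–(34) pp.282–283] -/
theorem prodExp_eq_exp_bch3List_add_eighth (l : List 𝔸) (h : ns l ≤ 1 / 8) :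
    ∃ R : 𝔸, (l.map exp).prod = exp (bch3List l + R) ∧ ‖R‖ ≤ 40000 * ns l ^ 4 := by
  refine ⟨logOnePlus ((l.map exp).prod - 1) - bch3List l, ?_, norm_log_prodExp_sub_bch3List_le_eighth l h⟩
  rw [add_sub_cancel, exp_log_prodExp l (lt_of_le_of_lt h (by linarith [one_fifth_lt_log_two]))]

/-- Four factors in print's regime: for `‖a‖+‖b‖+‖c‖+‖d‖ ≤ 1/8`,
`‖log(e^a e^b e^c e^d) − bch3List [a,b,c,d]‖ ≤ 40000(‖a‖+‖b‖+‖c‖+‖d‖)⁴`.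
[cite: Balaban1985Variational, (32)–(34) pp.282–283] -/
theorem norm_log_prodExp_four_sub_le_eighth (a b c d : 𝔸) (h : ‖a‖ + ‖b‖ + ‖c‖ + ‖d‖ ≤ 1 / 8) :
    ‖logOnePlus (exp a * exp b * exp c * exp d - 1) - bch3List [a, b, c, d]‖ ≤
      40000 * (‖a‖ + ‖b‖ + ‖c‖ + ‖d‖) ^ 4 := by
  have hns : ns [a, b, c, d] = ‖a‖ + ‖b‖ + ‖c‖ + ‖d‖ := by simp [add_assoc]
  have hprod : ([a, b, c, d].map exp).prod = exp a * exp b * exp c * exp d := by simp [mul_assoc]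
  have := norm_log_prodExp_sub_bch3List_le_eighth [a, b, c, d] (by rw [hns]; exact h)
  rwa [hns, hprod] at this

end Eighth

/-! ## §6  The logarithm of the product and the product versus the exponential of the cubic polynomial (v1.2)

For the passage from (34) to (35)–(36) one also wants the size of `W = log Πe^{Yᵢ}` itself (not only of `W − bch3List`):
`‖W‖ ≤ (4/3)Σ‖Yᵢ‖` on print's regime, so that `Πe^{Yᵢ} = e^{W}` and `e^{bch3List}` are exponentials of SMALL elements
differing by the `O(4)` tail — whence `‖Πe^{Yᵢ} − e^{bch3List}‖ = O((Σ‖Yᵢ‖)⁴)` by the local Lipschitz bound of `exp`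
(done in the consumer `B11Eq34Analytic`, which has that bound in its imports). -/

section LogSize

variable {𝔸 : Type*} [NormedRing 𝔸] [NormedAlgebra ℂ 𝔸] [CompleteSpace 𝔸]

/-- **Size of the logarithm of the product**: for `Σ‖Yᵢ‖ ≤ 1/8`, `‖log(e^{Y₁}⋯e^{Yₙ})‖ ≤ (4/3)Σ‖Yᵢ‖`
(`‖Π − 1‖ ≤ e^{s} − 1 ≤ s + s²` and `‖log(1 + T)‖ ≤ ‖T‖/(1 − ‖T‖)`). [cite: Rossmann2002, §1.3 Theorem 1, remark after (5)]
[cite: Balaban1985Variational, (32)–(34) pp.282–283] -/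
theorem norm_log_prodExp_le_eighth (l : List 𝔸) (h : ns l ≤ 1 / 8) :
    ‖logOnePlus ((l.map exp).prod - 1)‖ ≤ 4 / 3 * ns l := by
  have h0 := ns_nonneg l
  have hP : ‖(l.map exp).prod - 1‖ ≤ ns l + ns l ^ 2 :=
    (norm_prodExp_sub_one_le l).trans (exp_sub_one_le_add_sq h0 (by linarith))
  have hlt : ‖(l.map exp).prod - 1‖ < 1 := by nlinarith
  exact (norm_logOnePlus_le hlt).trans (div_one_sub_le_of_le_eighth hP h0 h)

/-- **The product as ONE exponential, with the size of the exponent**: for `Σ‖Yᵢ‖ ≤ 1/8` there is `R` with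
`Πe^{Yᵢ} = exp(bch3List + R)`, `‖R‖ ≤ 40000(Σ‖Yᵢ‖)⁴` AND `‖bch3List + R‖ ≤ (4/3)Σ‖Yᵢ‖` (`bch3List + R = log Π`);
also `‖bch3List‖ ≤ 2Σ‖Yᵢ‖`. [cite: Balaban1985Variational, (32)–(34) pp.282–283] -/
theorem prodExp_eq_exp_bch3List_add_eighth' (l : List 𝔸) (h : ns l ≤ 1 / 8) :
    ∃ R : 𝔸, (l.map exp).prod = exp (bch3List l + R) ∧ ‖R‖ ≤ 40000 * ns l ^ 4 ∧
      ‖bch3List l + R‖ ≤ 4 / 3 * ns l ∧ ‖bch3List l‖ ≤ 2 * ns l := by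
  refine ⟨logOnePlus ((l.map exp).prod - 1) - bch3List l, ?_, norm_log_prodExp_sub_bch3List_le_eighth l h, ?_,
    norm_bch3List_le l (by linarith)⟩
  · rw [add_sub_cancel, exp_log_prodExp l (lt_of_le_of_lt h (by linarith [one_fifth_lt_log_two]))]
  · rw [add_sub_cancel]; exact norm_log_prodExp_le_eighth l h

end LogSize

end Literature.Analysis.Calculus.BCH
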